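import Summits.HubbardSuperconductivity.HubbardSuperconductivity.Theses.ThermalWedge
import Summits.HubbardSuperconductivity.HubbardSuperconductivity.Theorems.ThermalWedgeTwSourcedInertnessReduction
import Literature.MathematicalPhysics.QuantumLattice.ApproximatingHamiltonianProofs
import Literature.MathematicalPhysics.QuantumLattice.DWaveSourceFreePressure
import Literature.MathematicalPhysics.QuantumLattice.GibbsEntropy
import Literature.MathematicalPhysics.QuantumLattice.TorusCooperSum
import Literature.MathematicalPhysics.QuantumLattice.TorusCooperSumRowWalk
import Literature.MathematicalPhysics.QuantumLattice.TorusCooperSumLogBound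
import Literature.MathematicalPhysics.QuantumLattice.LiebFluxPhaseProofs
import Literature.MathematicalPhysics.QuantumLattice.PatchPairOperator
import Literature.MathematicalPhysics.QuantumLattice.HubbardAtomicLimit
import Literature.MathematicalPhysics.QuantumLattice.HubbardWave0RayleighProofs
import Literature.MathematicalPhysics.QuantumLattice.PairCorrelationsODLROSupRayleighProofs
import Literature.MathematicalPhysics.QuantumLattice.HubbardCommutatorBound

/-!
# `TwSourcedInertness` — `T = 0` SHADOWS of the crux (sibling of `Disproof.lean`; cycle 1–2 content,
moved here in cycle 3 for the 200 kB cap of crux work files)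

Standing adversary's POSITIVE by-products, all of the form `TwSourcedInertness → …` (consequences
that would be refutation targets if a low-energy state with large `d`-wave pair amplitude existed —
none does at weak coupling: Kohn–Luttinger order is `e^{-c/U²} ≪ e^{-a/(2U)}`):

* §A/§B (copies of `Disproof.lean` §A/§B, new namespace): abstract thermal lemmas (`gain_le_mul_norm`,
  entropy sandwich `gain_ge_linear`, `sq_le_of_gain_le_quadratic`, `not_gain_le_quadratic_of_degenerate`),
  the crux's objects (`sourcedPressure`, `pairSource`, `‖Δ_d + Δ_dᴴ‖ ≤ 8√2L²`, large sources automatic);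
* §C `towerBound_of_inertness : TwSourcedInertness → TwGcTowerBound` — every state within `o(1)`
  energy density of the GC ground energy has pair amplitude density `≤ 2√(C(1+a/U) log 4)·e^{−a/(2U)}`;
* §F `kls_trial_state`, `gcLRO_bound_of_inertness : TwSourcedInertness → TwGcGroundStateLROBound`
  (Kennedy–Lieb–Shastry trial state: inertness caps the `d`-wave LRO of every GC-exposed ground state,
  no approximating-Hamiltonian theorem, no ensemble equivalence);
* §G `norm_dWaveDoubleCommutator_le : ‖[Δ_dᴴ,[H,Δ_d]]‖ ≤ κ(U,μ)L²` (graded locality) and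
  `gcExplicitCeiling_of_inertness : TwSourcedInertness → TwGcExplicitCeiling` — a COMPLETE proof that
  the crux alone yields the exponential ceiling `limsup P/L⁴ ≤ 4C(1+a/U) log 4 · e^{−a/U}` on
  GC-exposed ground-state `d`-wave LRO (planners: the cheap half of `TwCeilingGlue`).
Everything `lean check` rc 0, sorry-free, axioms standard. Census and negative results: `Disproof.lean`.
-/


noncomputable section

set_option linter.dupNamespace false

namespace Summit.HubbardSuperconductivity.HubbardSuperconductivity.Cruxes.TwSourcedInertness.KlsCeiling

open Matrix Finset Literature.MathematicalPhysics.QuantumLattice Literature.Probability.LatticeModels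
open Literature.MathematicalPhysics.QuantumLattice.RayleighBound

/-! ## §A Abstract thermal lemmas: pressure gain of a sourced Hamiltonian `H - h O` -/

section Abstract

open scoped Matrix.Norms.L2Operator ComplexOrder

variable {n : Type*} [Fintype n] [DecidableEq n] [Nonempty n]

/-- The (extensive) pressure gain `log Z_β(H - hO) - log Z_β(H)`. -/
def gain (β : ℝ) (H O : Matrix n n ℂ) (h : ℝ) : ℝ :=
  Real.log (partitionFn β (H - (h : ℂ) • O)).re - Real.log (partitionFn β H).re

omit [Fintype n] [DecidableEq n] [Nonempty n] in
theorem isHermitian_sub_smul {H O : Matrix n n ℂ} (hH : H.IsHermitian) (hO : O.IsHermitian)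
    (h : ℝ) : (H - (h : ℂ) • O).IsHermitian := by
  refine hH.sub (IsHermitian.smul hO ?_)
  rw [isSelfAdjoint_iff, Complex.star_def, Complex.conj_ofReal]

/-- **Large sources are automatic**: `log Z(H - hO) - log Z(H) ≤ β |h| ‖O‖`
(Lipschitz bound for the free energy). -/
theorem gain_le_mul_norm {H O : Matrix n n ℂ} (hH : H.IsHermitian) (hO : O.IsHermitian)
    {β : ℝ} (hβ : 0 ≤ β) (h : ℝ) : gain β H O h ≤ β * (|h| * ‖O‖) := by
  have key := log_partitionFn_sub_log_partitionFn_le (isHermitian_sub_smul hH hO h) hH hβ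
  have hnorm : ‖H - (H - (h : ℂ) • O)‖ = |h| * ‖O‖ := by
    rw [sub_sub_cancel, norm_smul, Complex.norm_real, Real.norm_eq_abs]
  rw [hnorm] at key
  exact key

/-- `log Z_β(E • 1) = log (card n) - β E`. -/
theorem log_partitionFn_smul_one (β E : ℝ) :
    Real.log (partitionFn β ((E : ℂ) • (1 : Matrix n n ℂ))).re =
      Real.log (Fintype.card n) - β * E := by
  have h0 : (0 : Matrix n n ℂ).IsHermitian := isHermitian_zero
  have h := log_partitionFn_add_smul_one h0 β E
  rw [zero_add] at h
  rw [h]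
  congr 1
  simp [partitionFn, gibbsWeight]

/-- `H ≥ E` (as an operator) bounds the free energy: `log Z_β(H) ≤ log (card n) - β E`. -/
theorem log_partitionFn_le_of_ge {H : Matrix n n ℂ} (hH : H.IsHermitian) {β : ℝ} (hβ : 0 ≤ β)
    {E : ℝ} (hE : (H - (E : ℂ) • (1 : Matrix n n ℂ)).PosSemidef) :
    Real.log (partitionFn β H).re ≤ Real.log (Fintype.card n) - β * E := by
  have h1 : ((E : ℂ) • (1 : Matrix n n ℂ)).IsHermitian := by
    refine IsHermitian.smul isHermitian_one ?_
    rw [isSelfAdjoint_iff, Complex.star_def, Complex.conj_ofReal]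
  rw [← log_partitionFn_smul_one β E]
  exact log_partitionFn_le_of_posSemidef h1 hH hβ hE

/-- Variational lower bound: `log Z_β(H) ≥ -β Re⟨v, H v⟩` for every unit vector `v`. -/
theorem neg_mul_rayleigh_le_log_partitionFn {H : Matrix n n ℂ} (hH : H.IsHermitian) {β : ℝ}
    (hβ : 0 ≤ β) {v : n → ℂ} (hv : star v ⬝ᵥ v = 1) :
    -(β * (star v ⬝ᵥ H *ᵥ v).re) ≤ Real.log (partitionFn β H).re := by
  have h1 := exp_neg_mul_groundEnergy_le_partitionFn hH β
  have h2 : H.groundEnergy ≤ (star v ⬝ᵥ H *ᵥ v).re := groundEnergy_le_rayleigh_holds hH v hv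
  have h3 : Real.exp (-(β * (star v ⬝ᵥ H *ᵥ v).re)) ≤ (partitionFn β H).re :=
    le_trans (Real.exp_le_exp.2 (by nlinarith)) h1
  have h4 := Real.log_le_log (Real.exp_pos _) h3
  rwa [Real.log_exp] at h4

/-- **Entropy-sandwich lower bound on the pressure gain.** For Hermitian `H ≥ E`, Hermitian `O`,
a unit vector `v`, `β ≥ 0` and real `h`:
`log Z(H - hO) - log Z(H) ≥ β (E - Re⟨v,Hv⟩) + β h Re⟨v,Ov⟩ - log card`. -/
theorem gain_ge_linear {H O : Matrix n n ℂ} (hH : H.IsHermitian) (hO : O.IsHermitian) {β : ℝ}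
    (hβ : 0 ≤ β) {E : ℝ} (hE : (H - (E : ℂ) • (1 : Matrix n n ℂ)).PosSemidef) {v : n → ℂ}
    (hv : star v ⬝ᵥ v = 1) (h : ℝ) :
    β * (E - (star v ⬝ᵥ H *ᵥ v).re) + β * h * (star v ⬝ᵥ O *ᵥ v).re
        - Real.log (Fintype.card n) ≤ gain β H O h := by
  have hup := log_partitionFn_le_of_ge hH hβ hE
  have hlow := neg_mul_rayleigh_le_log_partitionFn (isHermitian_sub_smul hH hO h) hβ hv
  have hexp : (star v ⬝ᵥ (H - (h : ℂ) • O) *ᵥ v).re =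
      (star v ⬝ᵥ H *ᵥ v).re - h * (star v ⬝ᵥ O *ᵥ v).re := by
    rw [sub_mulVec, dotProduct_sub, smul_mulVec, dotProduct_smul, Complex.sub_re,
      smul_eq_mul, Complex.re_ofReal_mul]
  rw [hexp] at hlow
  unfold gain
  nlinarith

/-- **Quadratic pressure gain caps the order parameter of every low-energy state.** If
`log Z(H - hO) - log Z(H) ≤ β K h²` for all real `h` (`K > 0`, `β > 0`) and `H ≥ E`, then every
unit vector `v` has `(Re⟨v,Ov⟩)² ≤ 4K (Re⟨v,Hv⟩ - E + log card / β)`. -/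
theorem sq_le_of_gain_le_quadratic {H O : Matrix n n ℂ} (hH : H.IsHermitian) (hO : O.IsHermitian)
    {β K : ℝ} (hβ : 0 < β) (hK : 0 < K)
    (hgain : ∀ h : ℝ, gain β H O h ≤ β * K * h ^ 2) {E : ℝ}
    (hE : (H - (E : ℂ) • (1 : Matrix n n ℂ)).PosSemidef) {v : n → ℂ} (hv : star v ⬝ᵥ v = 1) :
    (star v ⬝ᵥ O *ᵥ v).re ^ 2 ≤
      4 * K * ((star v ⬝ᵥ H *ᵥ v).re - E + Real.log (Fintype.card n) / β) := by
  set m := (star v ⬝ᵥ O *ᵥ v).re with hm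
  set R := (star v ⬝ᵥ H *ᵥ v).re with hR
  have key := (gain_ge_linear hH hO hβ.le hE hv (m / (2 * K))).trans (hgain (m / (2 * K)))
  -- divide by β
  have h1 : β * (m / (2 * K) * m - K * (m / (2 * K)) ^ 2) ≤
      β * (R - E) + Real.log (Fintype.card n) := by linarith [key]
  have hD : m / (2 * K) * m - K * (m / (2 * K)) ^ 2 ≤ R - E + Real.log (Fintype.card n) / β := by
    have hrw : R - E + Real.log (Fintype.card n) / β = (β * (R - E) + Real.log (Fintype.card n)) / β := by
      field_simp
    rw [hrw, le_div_iff₀ hβ]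
    linarith [h1]
  have hcalc : m / (2 * K) * m - K * (m / (2 * K)) ^ 2 = m ^ 2 / (4 * K) := by
    field_simp
    ring
  rw [hcalc, div_le_iff₀ (by positivity)] at hD
  linarith

/-- **Degenerate ground vectors kill the quadratic bound.** If `v` is a unit vector with
`Re⟨v,Hv⟩ = E`, `H ≥ E`, and `Re⟨v,Ov⟩ = m ≠ 0`, then `log Z(H - hO) - log Z(H) ≤ β K h²`
fails for some `h` as soon as `β > 4 K log card / m²`. -/
theorem not_gain_le_quadratic_of_degenerate {H O : Matrix n n ℂ} (hH : H.IsHermitian)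
    (hO : O.IsHermitian) {β K : ℝ} (hβ : 0 < β) (hK : 0 < K) {E : ℝ}
    (hE : (H - (E : ℂ) • (1 : Matrix n n ℂ)).PosSemidef) {v : n → ℂ} (hv : star v ⬝ᵥ v = 1)
    (hvE : (star v ⬝ᵥ H *ᵥ v).re = E)
    (hβK : 4 * K * Real.log (Fintype.card n) < β * (star v ⬝ᵥ O *ᵥ v).re ^ 2) :
    ¬ ∀ h : ℝ, gain β H O h ≤ β * K * h ^ 2 := by
  intro hgain
  have h := sq_le_of_gain_le_quadratic hH hO hβ hK hgain hE hv
  rw [hvE, sub_self, zero_add] at h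
  have h2 : β * (star v ⬝ᵥ O *ᵥ v).re ^ 2 ≤ 4 * K * Real.log (Fintype.card n) := by
    calc β * (star v ⬝ᵥ O *ᵥ v).re ^ 2 ≤ β * (4 * K * (Real.log (Fintype.card n) / β)) :=
          mul_le_mul_of_nonneg_left h hβ.le
      _ = 4 * K * Real.log (Fintype.card n) := by field_simp
  linarith

omit [Nonempty n] in
/-- A quadratic-form floor `E ‖x‖² ≤ Re⟨x,Hx⟩` gives the operator floor `H ≥ E`. (Stated through
quadratic forms so that concrete models need not mention the identity matrix.) -/
theorem posSemidef_sub_smul_one_of_forall {H : Matrix n n ℂ} (hH : H.IsHermitian) {E : ℝ}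
    (h : ∀ x : n → ℂ, E * (star x ⬝ᵥ x).re ≤ (star x ⬝ᵥ H *ᵥ x).re) :
    (H - (E : ℂ) • (1 : Matrix n n ℂ)).PosSemidef := by
  have h1 : ((E : ℂ) • (1 : Matrix n n ℂ)).IsHermitian := by
    refine IsHermitian.smul isHermitian_one ?_
    rw [isSelfAdjoint_iff, Complex.star_def, Complex.conj_ofReal]
  refine PosSemidef.of_dotProduct_mulVec_nonneg (hH.sub h1) fun x => ?_
  refine Complex.nonneg_iff.2 ⟨?_, ((hH.sub h1).im_star_dotProduct_mulVec_self x).symm⟩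
  rw [sub_mulVec, dotProduct_sub, smul_mulVec, one_mulVec, dotProduct_smul, Complex.sub_re,
    smul_eq_mul, Complex.re_ofReal_mul]
  linarith [h x]

/-- `sq_le_of_gain_le_quadratic` with the floor given as a quadratic-form bound. -/
theorem sq_le_of_gain_le_quadratic' {H O : Matrix n n ℂ} (hH : H.IsHermitian) (hO : O.IsHermitian)
    {β K : ℝ} (hβ : 0 < β) (hK : 0 < K)
    (hgain : ∀ h : ℝ, gain β H O h ≤ β * K * h ^ 2) {E : ℝ}
    (hE : ∀ x : n → ℂ, E * (star x ⬝ᵥ x).re ≤ (star x ⬝ᵥ H *ᵥ x).re) {v : n → ℂ}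
    (hv : star v ⬝ᵥ v = 1) :
    (star v ⬝ᵥ O *ᵥ v).re ^ 2 ≤
      4 * K * ((star v ⬝ᵥ H *ᵥ v).re - E + Real.log (Fintype.card n) / β) :=
  sq_le_of_gain_le_quadratic hH hO hβ hK hgain (posSemidef_sub_smul_one_of_forall hH hE) hv

end Abstract

/-! ## §B The crux's objects: sourced pressure of the Hubbard torus, large-`h` bound -/

section Torus

open scoped Matrix.Norms.L2Operator ComplexOrder

variable (L : ℕ) [NeZero L]

/-- The Hermitian `d`-wave pair source `O_L = Δ_d + Δ_dᴴ`, `Δ_d = pairField dWaveFormFactor L`. -/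
def pairSource : Matrix (Finset (Orb (FermionTorus 2 L))) (Finset (Orb (FermionTorus 2 L))) ℂ :=
  pairField dWaveFormFactor L + (pairField dWaveFormFactor L)ᴴ

/-- The sourced torus pressure `p̃_L(β,μ,U,h) = log Z_β(dWaveSourceTorus L U μ h) / (β L²)` — the
quantity of the crux (verbatim sub-expression of `TwSourcedInertness`). -/
def sourcedPressure (β U μ h : ℝ) : ℝ :=
  Real.log (partitionFn β (dWaveSourceTorus L U μ h)).re / (β * (L : ℝ) ^ 2)

theorem isHermitian_pairSource : (pairSource L).IsHermitian :=
  isHermitian_pairField_add_conjTranspose L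

omit [NeZero L] in
theorem isHermitian_hubbardTorusWith (U μ : ℝ) : (hubbardTorusWith 2 L 1 U μ).IsHermitian :=
  isHermitian_hamiltonianWith (G := fermionTorusGraph 2 L) 1 U μ

theorem dWaveSourceTorus_eq (U μ h : ℝ) :
    dWaveSourceTorus L U μ h = hubbardTorusWith 2 L 1 U μ - (h : ℂ) • pairSource L := rfl

/-- The crux's left-hand side is the abstract pressure gain divided by `β L²`. -/
theorem sourcedPressure_sub (β U μ h : ℝ) :
    sourcedPressure L β U μ h - sourcedPressure L β U μ 0 =
      gain β (hubbardTorusWith 2 L 1 U μ) (pairSource L) h / (β * (L : ℝ) ^ 2) := by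
  rw [sourcedPressure, sourcedPressure, dWaveSourceTorus_zero, gain, dWaveSourceTorus_eq, sub_div]

/-! ### Operator norm of the source: `‖Δ_d + Δ_dᴴ‖ ≤ 8√2 L²` -/

omit [NeZero L] in
theorem abs_dWaveFormFactor_le_one (e : Site 2) :
    |dWaveFormFactor e| ≤ 1 := by
  unfold dWaveFormFactor
  split_ifs <;> norm_num

omit [NeZero L] in
theorem sum_abs_dWaveFormFactor_le :
    ∑ e ∈ insert (0 : Site 2) unitSteps, |dWaveFormFactor e| ≤ 4 := by
  have h0 : (0 : Site 2) ∉ unitSteps := by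
    simp only [unitSteps, Finset.mem_insert, Finset.mem_singleton]; decide
  rw [Finset.sum_insert h0, dWaveFormFactor_zero, abs_zero, zero_add]
  calc ∑ e ∈ unitSteps, |dWaveFormFactor e| ≤ ∑ _e ∈ unitSteps, (1 : ℝ) :=
        Finset.sum_le_sum fun e _ => abs_dWaveFormFactor_le_one e
    _ = unitSteps.card := by rw [Finset.sum_const, nsmul_eq_mul, mul_one]
    _ ≤ 4 := by
        have : unitSteps.card ≤ 4 := by
          unfold unitSteps
          refine (Finset.card_insert_le _ _).trans ?_
          refine (Nat.succ_le_succ (Finset.card_insert_le _ _)).trans ?_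
          refine (Nat.succ_le_succ (Nat.succ_le_succ (Finset.card_insert_le _ _))).trans ?_
          rw [Finset.card_singleton]
        exact_mod_cast this

omit [NeZero L] in
theorem two_div_sqrt_two : (2 : ℝ) / Real.sqrt 2 = Real.sqrt 2 := by
  have hsqrt : (0 : ℝ) < Real.sqrt 2 := by positivity
  have h : Real.sqrt 2 * Real.sqrt 2 = 2 := Real.mul_self_sqrt zero_le_two
  rw [div_eq_iff (ne_of_gt hsqrt)]
  linarith [h]

omit [NeZero L] in
/-- A product of two annihilation operators has norm `≤ 1`. -/
theorem norm_annihilation_mul_le (o o' : Orb (FermionTorus 2 L)) :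
    ‖(annihilation o : Matrix (Finset (Orb (FermionTorus 2 L))) (Finset (Orb (FermionTorus 2 L))) ℂ) *
        annihilation o'‖ ≤ 1 := by
  have h1 := norm_annihilation_le_one (ι := Orb (FermionTorus 2 L)) o
  have h2 := norm_annihilation_le_one (ι := Orb (FermionTorus 2 L)) o'
  exact (norm_mul_le _ _).trans (mul_le_one₀ h1 (norm_nonneg _) h2)

/-- `‖P_x‖ ≤ (Σ_e |g e|) · √2` for the local pair operator with form factor `g`. -/
theorem norm_localPair_le (g : Site 2 → ℝ) (x : TorusSite 2 L) :
    ‖localPair g L x‖ ≤ (∑ e ∈ insert (0 : Site 2) unitSteps, |g e|) * Real.sqrt 2 := by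
  have hsqrt : (0 : ℝ) < Real.sqrt 2 := by positivity
  unfold localPair
  refine (norm_sum_le _ _).trans ?_
  rw [Finset.sum_mul]
  refine Finset.sum_le_sum fun e _ => ?_
  set A := (annihilation (orb (FermionTorus.ofTorusSite x) 0) *
      annihilation (orb (FermionTorus.ofTorusSite (x + Torus.proj L e)) 1) :
    Matrix (Finset (Orb (FermionTorus 2 L))) (Finset (Orb (FermionTorus 2 L))) ℂ) with hA
  set B := (annihilation (orb (FermionTorus.ofTorusSite x) 1) *
      annihilation (orb (FermionTorus.ofTorusSite (x + Torus.proj L e)) 0) :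
    Matrix (Finset (Orb (FermionTorus 2 L))) (Finset (Orb (FermionTorus 2 L))) ℂ) with hB
  have hAB : ‖A - B‖ ≤ 2 := by
    refine (norm_sub_le _ _).trans ?_
    have h1 : ‖A‖ ≤ 1 := norm_annihilation_mul_le L _ _
    have h2 : ‖B‖ ≤ 1 := norm_annihilation_mul_le L _ _
    linarith
  refine (norm_smul_le _ _).trans ?_
  rw [Complex.norm_real, Real.norm_eq_abs, abs_div, abs_of_pos hsqrt]
  calc |g e| / Real.sqrt 2 * ‖A - B‖ ≤ |g e| / Real.sqrt 2 * 2 :=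
        mul_le_mul_of_nonneg_left hAB (div_nonneg (abs_nonneg _) hsqrt.le)
    _ = |g e| * Real.sqrt 2 := by
        rw [div_mul_eq_mul_div, mul_div_assoc, two_div_sqrt_two]

/-- `‖P_x‖ ≤ 4√2` for the local `d`-wave pair operator. -/
theorem norm_localPair_dWave_le (x : TorusSite 2 L) :
    ‖localPair dWaveFormFactor L x‖ ≤ 4 * Real.sqrt 2 := by
  refine (norm_localPair_le L dWaveFormFactor x).trans ?_
  have hsqrt : (0 : ℝ) ≤ Real.sqrt 2 := Real.sqrt_nonneg _
  exact mul_le_mul_of_nonneg_right sum_abs_dWaveFormFactor_le hsqrt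

theorem card_torusSite : (Fintype.card (TorusSite 2 L) : ℝ) = (L : ℝ) ^ 2 := by
  rw [Fintype.card_pi, prod_const, ZMod.card, card_univ, Fintype.card_fin]
  push_cast
  ring

/-- `‖Δ_d‖ ≤ 4√2 L²`. -/
theorem norm_pairField_dWave_le :
    ‖pairField dWaveFormFactor L‖ ≤ 4 * Real.sqrt 2 * (L : ℝ) ^ 2 := by
  unfold pairField
  refine (norm_sum_le _ _).trans ?_
  calc ∑ x : TorusSite 2 L, ‖localPair dWaveFormFactor L x‖
        ≤ ∑ _x : TorusSite 2 L, 4 * Real.sqrt 2 :=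
          Finset.sum_le_sum fun x _ => norm_localPair_dWave_le L x
    _ = 4 * Real.sqrt 2 * (L : ℝ) ^ 2 := by
          rw [Finset.sum_const, card_univ, nsmul_eq_mul, card_torusSite]; ring

/-- **`‖Δ_d + Δ_dᴴ‖ ≤ 8√2 L²`** — the constant `8√2` of the crux's docstring. -/
theorem norm_pairSource_le : ‖pairSource L‖ ≤ 8 * Real.sqrt 2 * (L : ℝ) ^ 2 := by
  unfold pairSource
  refine (norm_add_le _ _).trans ?_
  rw [Matrix.l2_opNorm_conjTranspose]
  have h := norm_pairField_dWave_le L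
  linarith

/-- **Large sources are automatic for the crux**: for every `L`, `U`, `μ`, `β > 0` and real `h`,
`p̃_L(β,μ,U,h) − p̃_L(β,μ,U,0) ≤ 8√2 |h|`. Hence the crux's bound `C(1+log β)h²` holds for free
whenever `|h| ≥ 8√2 / (C (1 + log β))`; its content is the window `|h| < 8√2/(C(1+log β))`. -/
theorem sourcedPressure_sub_le_linear (U μ : ℝ) {β : ℝ} (hβ : 0 < β) (h : ℝ) :
    sourcedPressure L β U μ h - sourcedPressure L β U μ 0 ≤ 8 * Real.sqrt 2 * |h| := by
  rw [sourcedPressure_sub]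
  have hL : (0 : ℝ) < (L : ℝ) ^ 2 := by
    have : (0 : ℝ) < (L : ℝ) := by exact_mod_cast Nat.pos_of_ne_zero (NeZero.ne L)
    positivity
  rw [div_le_iff₀ (mul_pos hβ hL)]
  have h1 := gain_le_mul_norm (isHermitian_hubbardTorusWith L U μ) (isHermitian_pairSource L) hβ.le h
  have h2 := norm_pairSource_le L
  calc gain β (hubbardTorusWith 2 L 1 U μ) (pairSource L) h ≤ β * (|h| * ‖pairSource L‖) := h1
    _ ≤ β * (|h| * (8 * Real.sqrt 2 * (L : ℝ) ^ 2)) := by gcongr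
    _ = 8 * Real.sqrt 2 * |h| * (β * (L : ℝ) ^ 2) := by ring

/-- The crux's bound is automatic outside the window `|h| < 8√2 / (C(1 + log β))`. -/
theorem sourcedPressure_sub_le_of_large_h (U μ : ℝ) {β C : ℝ} (hβ : 0 < β)
    {h : ℝ} (hh : 8 * Real.sqrt 2 ≤ C * (1 + Real.log β) * |h|) :
    sourcedPressure L β U μ h - sourcedPressure L β U μ 0 ≤ C * (1 + Real.log β) * h ^ 2 := by
  refine (sourcedPressure_sub_le_linear L U μ hβ h).trans ?_
  calc 8 * Real.sqrt 2 * |h| ≤ C * (1 + Real.log β) * |h| * |h| :=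
        mul_le_mul_of_nonneg_right hh (abs_nonneg h)
    _ = C * (1 + Real.log β) * h ^ 2 := by rw [mul_assoc, ← sq, sq_abs]

/-! ### Dimension bookkeeping: `log dim Fock = L² log 4` -/

omit [NeZero L] in
theorem card_fock : Fintype.card (Finset (Orb (FermionTorus 2 L))) = 2 ^ (2 * L ^ 2) := by
  rw [Fintype.card_finset, card_orb]
  congr 1
  simp [FermionTorus, Fintype.card_lex]

omit [NeZero L] in
theorem log_card_fock :
    Real.log (Fintype.card (Finset (Orb (FermionTorus 2 L)))) = (L : ℝ) ^ 2 * Real.log 4 := by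
  rw [card_fock]
  push_cast
  rw [Real.log_pow, show (4 : ℝ) = 2 ^ 2 by norm_num, Real.log_pow]
  push_cast
  ring

end Torus

/-! ## §C A `T = 0` shadow of the crux: inertness caps the pair amplitude of every low-energy
GC state (the tower bound). This is a CONSEQUENCE of `TwSourcedInertness`, recorded as the
cheapest refutation target: any low-energy state of `hubbardTorusWith 2 L 1 U μ` with `d`-wave
pair amplitude `|Re⟨v,(Δ+Δᴴ)v⟩|/L² ≫ √(C(1+a/U)) e^{-a/(2U)}` would kill the crux. -/

section Tower

open scoped Matrix.Norms.L2Operator ComplexOrder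

/-- **GC tower bound** (consequence of the crux): in the crux's regime, for every energy floor
`E ≤ H := hubbardTorusWith 2 L 1 U μ` and every unit vector `v`,
`(Re⟨v,(Δ_d+Δ_dᴴ)v⟩/L²)² ≤ 4C(1+log β)·((Re⟨v,Hv⟩ − E)/L² + log 4/β)`. -/
def TwGcTowerBound : Prop :=
  ∀ μ₁ μ₂ : ℝ, -4 < μ₁ → μ₁ ≤ μ₂ → μ₂ < 0 → ∃ U₀ a C : ℝ, 0 < U₀ ∧ 0 < a ∧ 0 < C ∧
    ∀ U : ℝ, 0 < U → U ≤ U₀ → ∀ β : ℝ, 1 ≤ β → β ≤ Real.exp (a / U) → ∀ μ ∈ Set.Icc μ₁ μ₂,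
      ∃ L₀ : ℕ, ∀ (L : ℕ) [NeZero L], L₀ ≤ L →
        ∀ E : ℝ, (hubbardTorusWith 2 L 1 U μ - (E : ℂ) • 1).PosSemidef →
        ∀ v : Fock (Orb (FermionTorus 2 L)), star v ⬝ᵥ v = 1 →
          ((star v ⬝ᵥ pairSource L *ᵥ v).re / (L : ℝ) ^ 2) ^ 2 ≤
            4 * (C * (1 + Real.log β)) *
              (((star v ⬝ᵥ hubbardTorusWith 2 L 1 U μ *ᵥ v).re - E) / (L : ℝ) ^ 2 +
                Real.log 4 / β)

/-- From the crux's inequality at one `(β, L, U, μ)` to the extensive quadratic gain bound. -/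
theorem gain_le_of_crux (L : ℕ) [NeZero L] {β U μ C : ℝ} (hβ : 0 < β)
    (hcrux : ∀ h : ℝ, sourcedPressure L β U μ h - sourcedPressure L β U μ 0 ≤
      C * (1 + Real.log β) * h ^ 2) (h : ℝ) :
    gain β (hubbardTorusWith 2 L 1 U μ) (pairSource L) h ≤
      β * (C * (1 + Real.log β) * (L : ℝ) ^ 2) * h ^ 2 := by
  have hL : (0 : ℝ) < (L : ℝ) ^ 2 := by
    have : (0 : ℝ) < (L : ℝ) := by exact_mod_cast Nat.pos_of_ne_zero (NeZero.ne L)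
    positivity
  have h1 := hcrux h
  rw [sourcedPressure_sub, div_le_iff₀ (mul_pos hβ hL)] at h1
  linarith

/-- **The crux implies the GC tower bound.** -/
theorem towerBound_of_inertness
    (hI : Summit.HubbardSuperconductivity.HubbardSuperconductivity.Theses.ThermalWedge.TwSourcedInertness) :
    TwGcTowerBound := by
  intro μ₁ μ₂ h1 h2 h3
  obtain ⟨U₀, a, C, hU₀, ha, hC, hmain⟩ := hI μ₁ μ₂ h1 h2 h3
  refine ⟨U₀, a, C, hU₀, ha, hC, ?_⟩
  intro U hU hUU₀ β hβ hβa μ hμ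
  obtain ⟨L₀, hL⟩ := hmain U hU hUU₀ β hβ hβa μ hμ
  refine ⟨L₀, fun L _ hLL E hE v hv => ?_⟩
  have hβ0 : 0 < β := by linarith
  have hL2 : (0 : ℝ) < (L : ℝ) ^ 2 := by
    have : (0 : ℝ) < (L : ℝ) := by exact_mod_cast Nat.pos_of_ne_zero (NeZero.ne L)
    positivity
  have hlog : 0 < 1 + Real.log β := by
    have := Real.log_nonneg hβ
    linarith
  have hK : 0 < C * (1 + Real.log β) * (L : ℝ) ^ 2 := by positivity
  have hcrux : ∀ h : ℝ, sourcedPressure L β U μ h - sourcedPressure L β U μ 0 ≤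
      C * (1 + Real.log β) * h ^ 2 := fun h => hL L hLL h
  have key := sq_le_of_gain_le_quadratic (isHermitian_hubbardTorusWith L U μ)
    (isHermitian_pairSource L) hβ0 hK (gain_le_of_crux L hβ0 hcrux) hE hv
  rw [log_card_fock] at key
  set m := (star v ⬝ᵥ pairSource L *ᵥ v).re
  set R := (star v ⬝ᵥ hubbardTorusWith 2 L 1 U μ *ᵥ v).re
  have hgoal : (m / (L : ℝ) ^ 2) ^ 2 =
      m ^ 2 / ((L : ℝ) ^ 2 * (L : ℝ) ^ 2) := by rw [div_pow]; ring
  rw [hgoal, div_le_iff₀ (mul_pos hL2 hL2)]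
  calc m ^ 2 ≤ 4 * (C * (1 + Real.log β) * (L : ℝ) ^ 2) *
        (R - E + (L : ℝ) ^ 2 * Real.log 4 / β) := key
    _ = 4 * (C * (1 + Real.log β)) * ((R - E) / (L : ℝ) ^ 2 + Real.log 4 / β) *
        ((L : ℝ) ^ 2 * (L : ℝ) ^ 2) := by
          have hL0 : (L : ℝ) ≠ 0 := by exact_mod_cast NeZero.ne L
          field_simp

end Tower

/-! ## (from `Disproof.lean` §D) particle-number bookkeeping used by §F -/

/-! ## §D.1 Bridge: momentum modes are smeared modes of an orthonormal family -/

section Bridge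

open scoped Matrix.Norms.L2Operator ComplexOrder

variable {d L : ℕ} [NeZero L]

/-- The normalised plane-wave mode function of `(k, σ)`. -/
def modeFun (k : TorusSite d L) (σ : Fin 2) : Orb (FermionTorus d L) → ℂ :=
  fun o => torusFourierWeight d L * planeWave k σ o

theorem momentumAnnihilation_eq_annihilate (k : TorusSite d L) (σ : Fin 2) :
    momentumAnnihilation k σ = annihilate (modeFun k σ) := by
  rw [momentumAnnihilation_eq_sum_planeWave, annihilate]
  refine Finset.sum_congr rfl fun o _ => ?_
  simp only [modeFun, star_mul', star_torusFourierWeight, Complex.star_def]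

theorem momentumCreation_eq_create (k : TorusSite d L) (σ : Fin 2) :
    momentumCreation k σ = create (modeFun k σ) := by
  rw [momentumCreation, momentumAnnihilation_eq_annihilate, annihilate_conjTranspose]

theorem momentumNumber_eq_numberMode (k : TorusSite d L) (σ : Fin 2) :
    momentumNumber k σ = numberMode (modeFun k σ) := by
  rw [momentumNumber, momentumCreation_eq_create, momentumAnnihilation_eq_annihilate, numberMode]

/-- Orthonormality of the plane-wave modes, read off from the two forms of the mixed CAR. -/
theorem modeFun_orthonormal (k k' : TorusSite d L) (σ σ' : Fin 2) :
    star (modeFun k σ) ⬝ᵥ modeFun k' σ' = if k = k' ∧ σ = σ' then 1 else 0 := by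
  have h1 := annihilate_mul_create_add (modeFun k σ) (modeFun k' σ')
  have h2 := momentumAnnihilation_mul_momentumCreation_add k k' σ σ'
  rw [momentumAnnihilation_eq_annihilate, momentumCreation_eq_create, h1] at h2
  have h3 := congrFun (congrFun h2 ∅) ∅
  simp only [Matrix.smul_apply, Matrix.one_apply_eq, smul_eq_mul, mul_one] at h3
  rw [h3]
  split_ifs <;> simp

theorem modeFun_unit (k : TorusSite d L) (σ : Fin 2) : star (modeFun k σ) ⬝ᵥ modeFun k σ = 1 := by
  rw [modeFun_orthonormal]; simp

theorem modeFun_orthogonal {k k' : TorusSite d L} {σ σ' : Fin 2} (h : k ≠ k' ∨ σ ≠ σ') :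
    star (modeFun k σ) ⬝ᵥ modeFun k' σ' = 0 := by
  rw [modeFun_orthonormal, if_neg]
  rintro ⟨rfl, rfl⟩
  rcases h with h | h <;> exact h rfl

end Bridge

section ShellStates

variable {ι : Type*} [LinearOrder ι] [Fintype ι]

omit [LinearOrder ι] in
/-- Orthogonality of different particle-number sectors. -/
theorem IsNParticle.dotProduct_eq_zero {m n : ℕ} {φ ψ : Fock ι} (hφ : IsNParticle m φ)
    (hψ : IsNParticle n ψ) (hmn : m ≠ n) : star φ ⬝ᵥ ψ = 0 := by
  unfold dotProduct
  refine Finset.sum_eq_zero fun s _ => ?_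
  by_cases hs : s.card = m
  · rw [hψ s (by rw [hs]; exact hmn), mul_zero]
  · rw [Pi.star_apply, hφ s hs, star_zero, zero_mul]

end ShellStates

/-! ## §D.6 The `d`-wave pair amplitude of the shell state: `Re⟨v, (Δ_d + Δ_dᴴ) v⟩ = 3√2` -/

section PairAmplitude

open scoped Matrix.Norms.L2Operator ComplexOrder

/-- `Δ_d` lowers the particle number by two (any `L`). -/
theorem isNParticle_pairField_dWave_mulVec {L : ℕ} [NeZero L] {N : ℕ}
    {ψ : Fock (Orb (FermionTorus 2 L))} (hψ : IsNParticle (N + 2) ψ) :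
    IsNParticle N (pairField dWaveFormFactor L *ᵥ ψ) := by
  rw [pairField_dWave_eq_smul_pairOperator, neg_mulVec, smul_mulVec, pairOperator, sum_mulVec]
  refine (nParticleSubmodule N).neg_mem ((nParticleSubmodule N).smul_mem _
    ((nParticleSubmodule N).sum_mem fun k _ => ?_))
  rw [smul_mulVec]
  exact (nParticleSubmodule N).smul_mem _ (hψ.pairMode_mulVec k)

end PairAmplitude

section SectorBookkeeping

open scoped Matrix.Norms.L2Operator ComplexOrder

/-- `Δ_dᴴ` raises the particle number by two (any `L`). -/
theorem isNParticle_pairField_dWave_conjTranspose_mulVec {L : ℕ} [NeZero L] {N : ℕ}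
    {ψ : Fock (Orb (FermionTorus 2 L))} (hψ : IsNParticle N ψ) :
    IsNParticle (N + 2) ((pairField dWaveFormFactor L)ᴴ *ᵥ ψ) := by
  rw [pairField_dWave_eq_smul_pairOperator, conjTranspose_neg, conjTranspose_smul,
    pairOperator_conjTranspose, neg_mulVec, smul_mulVec, sum_mulVec]
  refine (nParticleSubmodule (N + 2)).neg_mem ((nParticleSubmodule (N + 2)).smul_mem _
    ((nParticleSubmodule (N + 2)).sum_mem fun k _ => ?_))
  rw [smul_mulVec, ← mulVec_mulVec, momentumCreation_eq_create, momentumCreation_eq_create]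
  exact (nParticleSubmodule (N + 2)).smul_mem _ ((hψ.create_mulVec _).create_mulVec _)

/-- Pair expectations vanish inside a fixed sector: `⟨ψ, Δ_d ψ⟩ = 0` for an `N`-particle `ψ`. -/
theorem star_dotProduct_pairField_mulVec_self_eq_zero {L : ℕ} [NeZero L] {N : ℕ}
    {ψ : Fock (Orb (FermionTorus 2 L))}
    (hψ : IsNParticle N ψ) : star ψ ⬝ᵥ (pairField dWaveFormFactor L *ᵥ ψ) = 0 := by
  rw [show star ψ ⬝ᵥ (pairField dWaveFormFactor L *ᵥ ψ) =
      star ((pairField dWaveFormFactor L)ᴴ *ᵥ ψ) ⬝ᵥ ψ by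
    rw [star_mulVec_dotProduct, conjTranspose_conjTranspose]]
  exact IsNParticle.dotProduct_eq_zero (isNParticle_pairField_dWave_conjTranspose_mulVec hψ) hψ
    (by omega)

end SectorBookkeeping

/-! ## §F Consequence II — the Kennedy–Lieb–Shastry trial state: inertness caps the `d`-wave
LRO of every GC-EXPOSED ground state (no approximating-Hamiltonian theorem, no ensemble equivalence)

Abstract step (`kls_trial_state`): if `ψ` is a unit global ground vector of `H` (`Hψ = Eψ`, `H ≥ E`)
and `A` lowers a conserved charge by a fixed amount (so that `⟨ψ,Aψ⟩ = ⟨ψ,A²ψ⟩ = ⟨Aψ,A²ψ⟩ = 0`), the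
state `v = (ψ + Aψ/‖Aψ‖)/√2` has pair amplitude `Re⟨v,(A+Aᴴ)v⟩² = ‖Aψ‖² = ⟨ψ,AᴴAψ⟩` and excess energy
`≤ ‖[Aᴴ,[H,A]]‖/(2‖Aψ‖²)`. With §C this turns the crux into a bound on `P = ⟨ψ, Δ_dᴴΔ_d ψ⟩` for every
`N`-particle global ground state of `hubbardTorusWith 2 L 1 U μ` (`gcLRO_bound_of_inertness`):
`P² ≤ 2C(1+log β)L²‖[Δ_dᴴ,[H,Δ_d]]‖ + 4C(1+log β)(L² log 4/β)·P`; since `‖[Δ_dᴴ,[H,Δ_d]]‖ = O(L²)`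
(graded locality, cf. `HubbardCommutatorBound`; not formalised here) this is the EXPONENTIAL CEILING
`limsup P/L⁴ ≤ 4C(1+a/U)·log 4·e^{−a/U}` for GC-exposed sectors — the route's `TwExponentialCeiling`
minus the `μ(δ)` bookkeeping, obtained WITHOUT `TwApproximatingHamiltonian`. -/

section KLS

open scoped Matrix.Norms.L2Operator ComplexOrder

variable {n : Type*} [Fintype n] [DecidableEq n]

omit [DecidableEq n] in
theorem star_dotProduct_comm' (x y : n → ℂ) : star x ⬝ᵥ y = star (star y ⬝ᵥ x) := by
  rw [← star_dotProduct_star, star_star]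

omit [DecidableEq n] in
theorem star_dotProduct_conjTranspose_mulVec' (A : Matrix n n ℂ) (x y : n → ℂ) :
    star x ⬝ᵥ (Aᴴ *ᵥ y) = star (star y ⬝ᵥ (A *ᵥ x)) := by
  rw [← star_mulVec_dotProduct, star_dotProduct_comm']

omit [DecidableEq n] in
/-- Expansion of a quadratic form on `c(x + d y)` for real `c, d`. -/
theorem quadForm_expand (M : Matrix n n ℂ) (x y : n → ℂ) (c d : ℝ) :
    star (((c : ℝ) : ℂ) • (x + ((d : ℝ) : ℂ) • y)) ⬝ᵥ (M *ᵥ (((c : ℝ) : ℂ) • (x + ((d : ℝ) : ℂ) • y))) =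
      ((c : ℝ) : ℂ) ^ 2 * (star x ⬝ᵥ (M *ᵥ x) + ((d : ℝ) : ℂ) * (star x ⬝ᵥ (M *ᵥ y)) +
        ((d : ℝ) : ℂ) * (star y ⬝ᵥ (M *ᵥ x)) + ((d : ℝ) : ℂ) ^ 2 * (star y ⬝ᵥ (M *ᵥ y))) := by
  simp only [mulVec_smul, mulVec_add, star_smul, star_add, smul_dotProduct, dotProduct_smul,
    add_dotProduct, dotProduct_add, smul_eq_mul, Complex.star_def, Complex.conj_ofReal]
  ring

theorem normForm_expand (x y : n → ℂ) (c d : ℝ) :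
    star (((c : ℝ) : ℂ) • (x + ((d : ℝ) : ℂ) • y)) ⬝ᵥ (((c : ℝ) : ℂ) • (x + ((d : ℝ) : ℂ) • y)) =
      ((c : ℝ) : ℂ) ^ 2 * (star x ⬝ᵥ x + ((d : ℝ) : ℂ) * (star x ⬝ᵥ y) +
        ((d : ℝ) : ℂ) * (star y ⬝ᵥ x) + ((d : ℝ) : ℂ) ^ 2 * (star y ⬝ᵥ y)) := by
  have h := quadForm_expand (1 : Matrix n n ℂ) x y c d
  simpa only [one_mulVec] using h

/-- `Re⟨ψ, D ψ⟩ ≤ ‖D‖` for a unit vector (operator norm `ℓ² → ℓ²`). -/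
theorem re_star_dotProduct_mulVec_le_norm (D : Matrix n n ℂ) {ψ : n → ℂ} (hψ : star ψ ⬝ᵥ ψ = 1) :
    (star ψ ⬝ᵥ (D *ᵥ ψ)).re ≤ ‖D‖ := by
  rw [← Matrix.l2_opNorm_toEuclideanCLM]
  exact re_star_dotProduct_mulVec_le_opNorm D hψ

/-- **Variational content of the double commutator**: for a unit global ground vector `ψ`
(`Hψ = Eψ`, `H ≥ E` as a quadratic form) and any `A`,
`Re⟨Aψ, H Aψ⟩ − E‖Aψ‖² ≤ ‖Aᴴ[H,A] − [H,A]Aᴴ‖`. -/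
theorem excess_energy_le_norm_double_commutator {H A : Matrix n n ℂ} (hH : H.IsHermitian) {E : ℝ}
    (hfloor : ∀ x : n → ℂ, E * (star x ⬝ᵥ x).re ≤ (star x ⬝ᵥ H *ᵥ x).re)
    {ψ : n → ℂ} (hψ : star ψ ⬝ᵥ ψ = 1) (hHψ : H *ᵥ ψ = (E : ℂ) • ψ) :
    (star (A *ᵥ ψ) ⬝ᵥ (H *ᵥ (A *ᵥ ψ))).re - E * (star (A *ᵥ ψ) ⬝ᵥ (A *ᵥ ψ)).re ≤
      ‖Aᴴ * (H * A - A * H) - (H * A - A * H) * Aᴴ‖ := by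
  set D := Aᴴ * (H * A - A * H) - (H * A - A * H) * Aᴴ with hDdef
  set φ := A *ᵥ ψ with hφ
  set χ := Aᴴ *ᵥ ψ with hχ
  have hbound := re_star_dotProduct_mulVec_le_norm D hψ
  have hHH : Hᴴ = H := hH.eq
  have hDψ : D *ᵥ ψ = Aᴴ *ᵥ (H *ᵥ φ) - (E : ℂ) • (Aᴴ *ᵥ φ) -
      (H *ᵥ (A *ᵥ χ) - A *ᵥ (H *ᵥ χ)) := by
    simp only [hDdef, hφ, hχ, sub_mulVec, mul_sub, ← mulVec_mulVec, hHψ, mulVec_smul]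
  have T1 : star ψ ⬝ᵥ (Aᴴ *ᵥ (H *ᵥ φ)) = star φ ⬝ᵥ (H *ᵥ φ) := by
    rw [hφ, star_mulVec_dotProduct]
  have T2 : star ψ ⬝ᵥ (Aᴴ *ᵥ φ) = star φ ⬝ᵥ φ := by
    rw [hφ, star_mulVec_dotProduct]
  have hAχ : star ψ ⬝ᵥ (A *ᵥ χ) = star χ ⬝ᵥ χ := by
    rw [hχ, star_mulVec_dotProduct, conjTranspose_conjTranspose]
  have T3 : star ψ ⬝ᵥ (H *ᵥ (A *ᵥ χ)) = (E : ℂ) * (star χ ⬝ᵥ χ) := by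
    have h1 : star ψ ⬝ᵥ (H *ᵥ (A *ᵥ χ)) = star (H *ᵥ ψ) ⬝ᵥ (A *ᵥ χ) := by
      rw [star_mulVec_dotProduct, hHH]
    rw [h1, hHψ, star_smul, smul_dotProduct, Complex.star_def, Complex.conj_ofReal, smul_eq_mul, hAχ]
  have T4 : star ψ ⬝ᵥ (A *ᵥ (H *ᵥ χ)) = star χ ⬝ᵥ (H *ᵥ χ) := by
    rw [hχ, star_mulVec_dotProduct, conjTranspose_conjTranspose]
  have hsum : star ψ ⬝ᵥ (D *ᵥ ψ) =
      (star φ ⬝ᵥ (H *ᵥ φ) - (E : ℂ) * (star φ ⬝ᵥ φ)) +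
        (star χ ⬝ᵥ (H *ᵥ χ) - (E : ℂ) * (star χ ⬝ᵥ χ)) := by
    rw [hDψ, dotProduct_sub, dotProduct_sub, dotProduct_sub, dotProduct_smul, T1, T2, T3, T4,
      smul_eq_mul]
    ring
  have hre : (star ψ ⬝ᵥ (D *ᵥ ψ)).re =
      ((star φ ⬝ᵥ (H *ᵥ φ)).re - E * (star φ ⬝ᵥ φ).re) +
        ((star χ ⬝ᵥ (H *ᵥ χ)).re - E * (star χ ⬝ᵥ χ).re) := by
    rw [hsum]
    simp only [Complex.add_re, Complex.sub_re, Complex.re_ofReal_mul]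
  have hχfloor := hfloor χ
  rw [hre] at hbound
  linarith

/-- **The Kennedy–Lieb–Shastry trial state.** For a unit global ground vector `ψ` of `H` and an
operator `A` with `⟨ψ,Aψ⟩ = ⟨ψ,A²ψ⟩ = ⟨Aψ,A²ψ⟩ = 0` (e.g. `A` lowers a conserved particle number by
two) and `P = ‖Aψ‖² > 0`, the unit vector `v = (ψ + Aψ/√P)/√2` has
`Re⟨v,(A+Aᴴ)v⟩² = P` and `Re⟨v,Hv⟩ − E ≤ ‖Aᴴ[H,A] − [H,A]Aᴴ‖ / (2P)`. -/
theorem kls_trial_state {H A : Matrix n n ℂ} (hH : H.IsHermitian) {E : ℝ}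
    (hfloor : ∀ x : n → ℂ, E * (star x ⬝ᵥ x).re ≤ (star x ⬝ᵥ H *ᵥ x).re)
    {ψ : n → ℂ} (hψ : star ψ ⬝ᵥ ψ = 1) (hHψ : H *ᵥ ψ = (E : ℂ) • ψ)
    (hO1 : star ψ ⬝ᵥ (A *ᵥ ψ) = 0) (hO2 : star ψ ⬝ᵥ (A *ᵥ (A *ᵥ ψ)) = 0)
    (hO3 : star (A *ᵥ ψ) ⬝ᵥ (A *ᵥ (A *ᵥ ψ)) = 0)
    (hP : 0 < (star (A *ᵥ ψ) ⬝ᵥ (A *ᵥ ψ)).re) :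
    ∃ v : n → ℂ, star v ⬝ᵥ v = 1 ∧
      (star v ⬝ᵥ ((A + Aᴴ) *ᵥ v)).re ^ 2 = (star (A *ᵥ ψ) ⬝ᵥ (A *ᵥ ψ)).re ∧
      (star v ⬝ᵥ (H *ᵥ v)).re - E ≤
        ‖Aᴴ * (H * A - A * H) - (H * A - A * H) * Aᴴ‖ / (2 * (star (A *ᵥ ψ) ⬝ᵥ (A *ᵥ ψ)).re) := by
  -- abbreviations (kept syntactically as `A *ᵥ ψ` to avoid `set` bookkeeping)
  have hPc : star (A *ᵥ ψ) ⬝ᵥ (A *ᵥ ψ) = (((star (A *ᵥ ψ) ⬝ᵥ (A *ᵥ ψ)).re : ℝ) : ℂ) := by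
    have h0 := dotProduct_star_self_nonneg (A *ᵥ ψ)
    obtain ⟨_, him⟩ := Complex.nonneg_iff.mp h0
    apply Complex.ext
    · simp
    · simp [← him]
  set P : ℝ := (star (A *ᵥ ψ) ⬝ᵥ (A *ᵥ ψ)).re with hPdef
  set d : ℝ := (Real.sqrt P)⁻¹ with hd
  set c : ℝ := (Real.sqrt 2)⁻¹ with hc
  have hsqrtP : 0 < Real.sqrt P := Real.sqrt_pos.mpr hP
  have hd2 : d ^ 2 * P = 1 := by
    rw [hd, inv_pow, Real.sq_sqrt hP.le, inv_mul_cancel₀ hP.ne']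
  have hdP : d * P = Real.sqrt P := by
    rw [hd, inv_mul_eq_div, div_eq_iff hsqrtP.ne', ← sq, Real.sq_sqrt hP.le]
  have hc2 : c ^ 2 = 1 / 2 := by rw [hc, inv_pow, Real.sq_sqrt zero_le_two, one_div]
  have hHH : Hᴴ = H := hH.eq
  -- scalar products entering the expansions
  have e_ψφ : star ψ ⬝ᵥ (A *ᵥ ψ) = 0 := hO1
  have e_φψ : star (A *ᵥ ψ) ⬝ᵥ ψ = 0 := by rw [star_dotProduct_comm', e_ψφ, star_zero]
  have e_ψAφ : star ψ ⬝ᵥ (A *ᵥ (A *ᵥ ψ)) = 0 := hO2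
  have e_ψAHφ : star ψ ⬝ᵥ (Aᴴ *ᵥ (A *ᵥ ψ)) = (P : ℂ) := by
    rw [← star_mulVec_dotProduct]; exact hPc
  have e_φAψ : star (A *ᵥ ψ) ⬝ᵥ (A *ᵥ ψ) = (P : ℂ) := hPc
  have e_φAHψ : star (A *ᵥ ψ) ⬝ᵥ (Aᴴ *ᵥ ψ) = 0 := by
    rw [star_dotProduct_conjTranspose_mulVec', e_ψAφ, star_zero]
  have e_φAφ : star (A *ᵥ ψ) ⬝ᵥ (A *ᵥ (A *ᵥ ψ)) = 0 := hO3
  have e_φAHφ : star (A *ᵥ ψ) ⬝ᵥ (Aᴴ *ᵥ (A *ᵥ ψ)) = 0 := by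
    rw [star_dotProduct_conjTranspose_mulVec', e_φAφ, star_zero]
  have e_ψAψ : star ψ ⬝ᵥ (Aᴴ *ᵥ ψ) = 0 := by
    rw [star_dotProduct_conjTranspose_mulVec', e_ψφ, star_zero]
  have e_ψHψ : star ψ ⬝ᵥ (H *ᵥ ψ) = (E : ℂ) := by
    rw [hHψ, dotProduct_smul, hψ, smul_eq_mul, mul_one]
  have e_φHψ : star (A *ᵥ ψ) ⬝ᵥ (H *ᵥ ψ) = 0 := by
    rw [hHψ, dotProduct_smul, e_φψ, smul_zero]
  have e_ψHφ : star ψ ⬝ᵥ (H *ᵥ (A *ᵥ ψ)) = 0 := by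
    rw [← hHH, star_dotProduct_conjTranspose_mulVec', e_φHψ, star_zero]
  refine ⟨((c : ℝ) : ℂ) • (ψ + ((d : ℝ) : ℂ) • (A *ᵥ ψ)), ?_, ?_, ?_⟩
  · -- normalisation
    rw [normForm_expand, hψ, e_ψφ, e_φψ, e_φAψ]
    have : ((c : ℝ) : ℂ) ^ 2 * (1 + ((d : ℝ) : ℂ) * 0 + ((d : ℝ) : ℂ) * 0 + ((d : ℝ) : ℂ) ^ 2 * (P : ℂ)) =
        (((c ^ 2 * (1 + d ^ 2 * P)) : ℝ) : ℂ) := by push_cast; ring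
    rw [this, hd2, hc2]
    norm_num
  · -- pair amplitude
    rw [quadForm_expand]
    simp only [add_mulVec, dotProduct_add, e_ψφ, e_ψAψ, e_ψAφ, e_ψAHφ, e_φAψ, e_φAHψ, e_φAφ, e_φAHφ]
    have : ((c : ℝ) : ℂ) ^ 2 * (0 + 0 + ((d : ℝ) : ℂ) * (0 + (P : ℂ)) + ((d : ℝ) : ℂ) * ((P : ℂ) + 0) +
        ((d : ℝ) : ℂ) ^ 2 * (0 + 0)) = (((c ^ 2 * (2 * (d * P))) : ℝ) : ℂ) := by push_cast; ring
    rw [this, Complex.ofReal_re, hdP, hc2, show (1 / 2 : ℝ) * (2 * Real.sqrt P) = Real.sqrt P by ring,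
      Real.sq_sqrt hP.le]
  · -- energy
    have hex := excess_energy_le_norm_double_commutator (A := A) hH hfloor hψ hHψ
    rw [quadForm_expand, e_ψHψ, e_ψHφ, e_φHψ]
    set X : ℝ := (star (A *ᵥ ψ) ⬝ᵥ (H *ᵥ (A *ᵥ ψ))).re with hX
    have hre : (((c : ℝ) : ℂ) ^ 2 * ((E : ℂ) + ((d : ℝ) : ℂ) * 0 + ((d : ℝ) : ℂ) * 0 +
        ((d : ℝ) : ℂ) ^ 2 * (star (A *ᵥ ψ) ⬝ᵥ (H *ᵥ (A *ᵥ ψ))))).re = c ^ 2 * (E + d ^ 2 * X) := by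
      have h1 : ((c : ℝ) : ℂ) ^ 2 * ((E : ℂ) + ((d : ℝ) : ℂ) * 0 + ((d : ℝ) : ℂ) * 0 +
          ((d : ℝ) : ℂ) ^ 2 * (star (A *ᵥ ψ) ⬝ᵥ (H *ᵥ (A *ᵥ ψ)))) =
          ((c ^ 2 : ℝ) : ℂ) * ((E : ℂ) + ((d ^ 2 : ℝ) : ℂ) * (star (A *ᵥ ψ) ⬝ᵥ (H *ᵥ (A *ᵥ ψ)))) := by
        push_cast; ring
      rw [h1, Complex.re_ofReal_mul, Complex.add_re, Complex.ofReal_re, Complex.re_ofReal_mul, ← hX]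
    rw [hre, hc2]
    have hd2' : d ^ 2 = 1 / P := by
      rw [eq_div_iff hP.ne']; exact hd2
    have hrw : 1 / 2 * (E + 1 / P * X) = E / 2 + X / (2 * P) := by
      field_simp
    rw [hd2', sub_le_iff_le_add, hrw]
    have h2P : (0 : ℝ) < 2 * P := by positivity
    have hXle : X / (2 * P) ≤ (‖Aᴴ * (H * A - A * H) - (H * A - A * H) * Aᴴ‖ + E * P) / (2 * P) := by
      apply div_le_div_of_nonneg_right _ h2P.le
      linarith
    have hsplit : (‖Aᴴ * (H * A - A * H) - (H * A - A * H) * Aᴴ‖ + E * P) / (2 * P) =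
        ‖Aᴴ * (H * A - A * H) - (H * A - A * H) * Aᴴ‖ / (2 * P) + E / 2 := by
      field_simp
    rw [hsplit] at hXle
    linarith

end KLS

section GCLRO

open scoped Matrix.Norms.L2Operator ComplexOrder

/-- The double commutator `[Δ_dᴴ, [H, Δ_d]]` of the `L`-torus (its norm is `O(L²)` by graded
locality; that estimate is NOT formalised here and enters the ceiling only through this norm). -/
def dWaveDoubleCommutator (L : ℕ) [NeZero L] (U μ : ℝ) :
    Matrix (Finset (Orb (FermionTorus 2 L))) (Finset (Orb (FermionTorus 2 L))) ℂ :=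
  (pairField dWaveFormFactor L)ᴴ *
      (hubbardTorusWith 2 L 1 U μ * pairField dWaveFormFactor L -
        pairField dWaveFormFactor L * hubbardTorusWith 2 L 1 U μ) -
    (hubbardTorusWith 2 L 1 U μ * pairField dWaveFormFactor L -
        pairField dWaveFormFactor L * hubbardTorusWith 2 L 1 U μ) * (pairField dWaveFormFactor L)ᴴ

/-- **GC-exposed LRO bound** (consequence of the crux): in the crux's regime, every `N`-particle
(`N ≥ 4`) unit GLOBAL ground vector `ψ` of `H = hubbardTorusWith 2 L 1 U μ` (`Hψ = Eψ`, `H ≥ E`)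
has `d`-wave order `P = ⟨ψ, Δ_dᴴΔ_d ψ⟩` obeying
`P² ≤ 2K‖[Δ_dᴴ,[H,Δ_d]]‖ + 4K(L² log 4/β)·P`, `K = C(1+log β)L²`. With `‖[Δ_dᴴ,[H,Δ_d]]‖ ≤ κ L²`
this reads `(P/L⁴)² ≤ 2C(1+log β)κ/L⁴ + 4C(1+log β)(log 4/β)(P/L⁴)`: an exponential ceiling
`e^{−a/U}` on GC-exposed ground-state `d`-wave LRO, from inertness ALONE. -/
def TwGcGroundStateLROBound : Prop :=
  ∀ μ₁ μ₂ : ℝ, -4 < μ₁ → μ₁ ≤ μ₂ → μ₂ < 0 → ∃ U₀ a C : ℝ, 0 < U₀ ∧ 0 < a ∧ 0 < C ∧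
    ∀ U : ℝ, 0 < U → U ≤ U₀ → ∀ β : ℝ, 1 ≤ β → β ≤ Real.exp (a / U) → ∀ μ ∈ Set.Icc μ₁ μ₂,
      ∃ L₀ : ℕ, ∀ (L : ℕ) [NeZero L], L₀ ≤ L →
        ∀ (M : ℕ) (E : ℝ) (ψ : Fock (Orb (FermionTorus 2 L))), star ψ ⬝ᵥ ψ = 1 →
          IsNParticle (M + 4) ψ → hubbardTorusWith 2 L 1 U μ *ᵥ ψ = (E : ℂ) • ψ →
          (∀ x, E * (star x ⬝ᵥ x).re ≤ (star x ⬝ᵥ hubbardTorusWith 2 L 1 U μ *ᵥ x).re) →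
          (star ψ ⬝ᵥ ((pairField dWaveFormFactor L)ᴴ * pairField dWaveFormFactor L) *ᵥ ψ).re ^ 2 ≤
            2 * (C * (1 + Real.log β) * (L : ℝ) ^ 2) * ‖dWaveDoubleCommutator L U μ‖ +
              4 * (C * (1 + Real.log β) * (L : ℝ) ^ 2) * ((L : ℝ) ^ 2 * Real.log 4 / β) *
                (star ψ ⬝ᵥ ((pairField dWaveFormFactor L)ᴴ * pairField dWaveFormFactor L) *ᵥ ψ).re

/-- **The crux implies the GC-exposed LRO bound** (KLS trial state + entropy sandwich). -/
theorem gcLRO_bound_of_inertness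
    (hI : Summit.HubbardSuperconductivity.HubbardSuperconductivity.Theses.ThermalWedge.TwSourcedInertness) :
    TwGcGroundStateLROBound := by
  intro μ₁ μ₂ h1 h2 h3
  obtain ⟨U₀, a, C, hU₀, ha, hC, hmain⟩ := hI μ₁ μ₂ h1 h2 h3
  refine ⟨U₀, a, C, hU₀, ha, hC, ?_⟩
  intro U hU hUU₀ β hβ hβa μ hμ
  obtain ⟨L₀, hL⟩ := hmain U hU hUU₀ β hβ hβa μ hμ
  refine ⟨L₀, fun L _ hLL M E ψ hψ hN hHψ hfloor => ?_⟩
  set Δ := pairField dWaveFormFactor L with hΔ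
  set H := hubbardTorusWith 2 L 1 U μ with hH
  have hβ0 : 0 < β := by linarith
  have hL2 : (0 : ℝ) < (L : ℝ) ^ 2 := by
    have : (0 : ℝ) < (L : ℝ) := by exact_mod_cast Nat.pos_of_ne_zero (NeZero.ne L)
    positivity
  have hlog : 0 < 1 + Real.log β := by have := Real.log_nonneg hβ; linarith
  have hK : 0 < C * (1 + Real.log β) * (L : ℝ) ^ 2 := by positivity
  set K := C * (1 + Real.log β) * (L : ℝ) ^ 2 with hKdef
  -- P = ‖Δψ‖² ≥ 0
  have hPeq : star ψ ⬝ᵥ ((Δᴴ * Δ) *ᵥ ψ) = star (Δ *ᵥ ψ) ⬝ᵥ (Δ *ᵥ ψ) := by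
    rw [← mulVec_mulVec, ← star_mulVec_dotProduct]
  set P : ℝ := (star ψ ⬝ᵥ ((Δᴴ * Δ) *ᵥ ψ)).re with hPdef
  have hP' : (star (Δ *ᵥ ψ) ⬝ᵥ (Δ *ᵥ ψ)).re = P := by rw [hPdef, hPeq]
  have hPnn : 0 ≤ P := by
    rw [← hP']
    exact (Complex.nonneg_iff.mp (dotProduct_star_self_nonneg (Δ *ᵥ ψ))).1
  have hnorm : 0 ≤ ‖dWaveDoubleCommutator L U μ‖ := norm_nonneg _
  have hΛ : 0 ≤ (L : ℝ) ^ 2 * Real.log 4 / β := by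
    have : 0 ≤ Real.log 4 := Real.log_nonneg (by norm_num)
    positivity
  rcases hPnn.eq_or_lt with hP0 | hPpos
  · -- P = 0: trivial
    rw [← hP0]
    nlinarith
  -- the KLS trial state
  have hO1 : star ψ ⬝ᵥ (Δ *ᵥ ψ) = 0 := star_dotProduct_pairField_mulVec_self_eq_zero hN
  have hΔψ : IsNParticle (M + 2) (Δ *ᵥ ψ) := isNParticle_pairField_dWave_mulVec hN
  have hΔΔψ : IsNParticle M (Δ *ᵥ (Δ *ᵥ ψ)) := isNParticle_pairField_dWave_mulVec hΔψ
  have hO2 : star ψ ⬝ᵥ (Δ *ᵥ (Δ *ᵥ ψ)) = 0 := IsNParticle.dotProduct_eq_zero hN hΔΔψ (by omega)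
  have hO3 : star (Δ *ᵥ ψ) ⬝ᵥ (Δ *ᵥ (Δ *ᵥ ψ)) = 0 :=
    IsNParticle.dotProduct_eq_zero hΔψ hΔΔψ (by omega)
  have hPpos' : 0 < (star (Δ *ᵥ ψ) ⬝ᵥ (Δ *ᵥ ψ)).re := by rw [hP']; exact hPpos
  obtain ⟨v, hv, hm, hE⟩ := kls_trial_state (isHermitian_hubbardTorusWith L U μ) hfloor hψ hHψ
    hO1 hO2 hO3 hPpos'
  rw [hP'] at hm hE
  -- the entropy sandwich for v
  have hcrux : ∀ h : ℝ, sourcedPressure L β U μ h - sourcedPressure L β U μ 0 ≤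
      C * (1 + Real.log β) * h ^ 2 := fun h => hL L hLL h
  have key := sq_le_of_gain_le_quadratic' (isHermitian_hubbardTorusWith L U μ)
    (isHermitian_pairSource L) hβ0 hK (gain_le_of_crux L hβ0 hcrux) hfloor hv
  rw [log_card_fock] at key
  have hm' : (star v ⬝ᵥ pairSource L *ᵥ v).re ^ 2 = P := hm
  rw [hm'] at key
  -- P ≤ 4K((R−E) + L²Λ/β) and R − E ≤ ‖D‖/(2P)  ⇒  P² ≤ 2K‖D‖ + 4K(L²Λ/β)P
  have hD : (star v ⬝ᵥ hubbardTorusWith 2 L 1 U μ *ᵥ v).re - E ≤ ‖dWaveDoubleCommutator L U μ‖ / (2 * P) :=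
    hE
  have h4K : 0 ≤ 4 * K := by positivity
  have step : P ≤ 4 * K * (‖dWaveDoubleCommutator L U μ‖ / (2 * P) + (L : ℝ) ^ 2 * Real.log 4 / β) := by
    calc P ≤ 4 * K * ((star v ⬝ᵥ hubbardTorusWith 2 L 1 U μ *ᵥ v).re - E + (L : ℝ) ^ 2 * Real.log 4 / β) :=
          key
      _ ≤ _ := by gcongr
  have hmul := mul_le_mul_of_nonneg_left step hPpos.le
  have hrhs : P * (4 * K * (‖dWaveDoubleCommutator L U μ‖ / (2 * P) + (L : ℝ) ^ 2 * Real.log 4 / β)) =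
      2 * K * ‖dWaveDoubleCommutator L U μ‖ + 4 * K * ((L : ℝ) ^ 2 * Real.log 4 / β) * P := by
    field_simp
    ring
  rw [hrhs] at hmul
  nlinarith


end GCLRO

/-! ## §G The double commutator `[Δ_dᴴ,[H,Δ_d]]` is `O(L²)` (graded locality) — makes §F explicit

All CAR-subalgebra memberships are proved GENERICALLY (over any finite `Λ`) and only instantiated on
the torus: at the concrete orbital type `Orb (FermionTorus 2 L)` the two `DecidableEq` instance paths
make `Subalgebra.*_mem _` elaboration time out (cf. the design note of `ReducedBCSTorus.lean`). -/

section CarGeneric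

variable {Λ : Type*} [LinearOrder Λ] [Fintype Λ]

/-- `orbSet` is monotone. -/
theorem orbSet_mono_local {X Y : Finset Λ} (h : X ⊆ Y) : orbSet X ⊆ orbSet Y :=
  fun k hk => by rw [mem_orbSet] at hk ⊢; exact h hk

/-- `c_i c_j` is even. -/
theorem annihilation_mul_annihilation_mem_carEvenSubalgebra' {S : Finset (Orb Λ)} {i j : Orb Λ}
    (hi : i ∈ S) (hj : j ∈ S) : annihilation i * annihilation j ∈ carEvenSubalgebra S :=
  Algebra.subset_adjoin ⟨(i, false), (j, false), hi, hj, rfl⟩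

/-- `c†_i c†_j` is even. -/
theorem creation_mul_creation_mem_carEvenSubalgebra' {S : Finset (Orb Λ)} {i j : Orb Λ}
    (hi : i ∈ S) (hj : j ∈ S) : creation i * creation j ∈ carEvenSubalgebra S :=
  Algebra.subset_adjoin ⟨(i, true), (j, true), hi, hj, rfl⟩

/-- A generic singlet-pair sum `Σ_e κ_e (c_{X↑} c_{Y_e↓} − c_{X↓} c_{Y_e↑})` is even on any site set
containing `X` and the `Y_e`. -/
theorem pairSum_mem_carEvenSubalgebra {τ : Type*} (T : Finset τ) (κ : τ → ℝ) (X : Λ) (Y : τ → Λ)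
    {S : Finset Λ} (hX : X ∈ S) (hY : ∀ e ∈ T, Y e ∈ S) :
    (∑ e ∈ T, ((κ e : ℝ) : ℂ) •
        (annihilation (orb X 0) * annihilation (orb (Y e) 1) -
          annihilation (orb X 1) * annihilation (orb (Y e) 0))) ∈ carEvenSubalgebra (orbSet S) := by
  refine Subalgebra.sum_mem _ fun e he => Subalgebra.smul_mem _ (Subalgebra.sub_mem _ ?_ ?_) _
  · exact annihilation_mul_annihilation_mem_carEvenSubalgebra' (orb_mem_orbSet hX _)
      (orb_mem_orbSet (hY e he) _)
  · exact annihilation_mul_annihilation_mem_carEvenSubalgebra' (orb_mem_orbSet hX _)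
      (orb_mem_orbSet (hY e he) _)

/-- … and so is its adjoint. -/
theorem pairSum_conjTranspose_mem_carEvenSubalgebra {τ : Type*} (T : Finset τ) (κ : τ → ℝ) (X : Λ)
    (Y : τ → Λ) {S : Finset Λ} (hX : X ∈ S) (hY : ∀ e ∈ T, Y e ∈ S) :
    (∑ e ∈ T, ((κ e : ℝ) : ℂ) •
        (annihilation (orb X 0) * annihilation (orb (Y e) 1) -
          annihilation (orb X 1) * annihilation (orb (Y e) 0)))ᴴ ∈ carEvenSubalgebra (orbSet S) := by
  rw [conjTranspose_sum]
  refine Subalgebra.sum_mem _ fun e he => ?_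
  rw [conjTranspose_smul, conjTranspose_sub, conjTranspose_mul, conjTranspose_mul,
    annihilation_conjTranspose, annihilation_conjTranspose, annihilation_conjTranspose,
    annihilation_conjTranspose]
  refine Subalgebra.smul_mem _ (Subalgebra.sub_mem _ ?_ ?_) _
  · exact creation_mul_creation_mem_carEvenSubalgebra' (orb_mem_orbSet (hY e he) _)
      (orb_mem_orbSet hX _)
  · exact creation_mul_creation_mem_carEvenSubalgebra' (orb_mem_orbSet (hY e he) _)
      (orb_mem_orbSet hX _)

variable (G : SimpleGraph Λ) [DecidableRel G.Adj]

/-- **`[H, A]` is localised in any set containing all term supports meeting the support of `A`.** -/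
theorem commutator_mem_carSubalgebra (t U μ : ℝ) {W N : Finset Λ} (hWN : W ⊆ N)
    (hN : ∀ Z : HubbardIdx G, ¬ Disjoint (hubbardTermSupp G Z) W → hubbardTermSupp G Z ⊆ N)
    {A : Matrix (Finset (Orb Λ)) (Finset (Orb Λ)) ℂ} (hA : A ∈ carSubalgebra (orbSet W)) :
    hamiltonianWith G t U μ * A - A * hamiltonianWith G t U μ ∈ carSubalgebra (orbSet N) := by
  have hA' : A ∈ carSubalgebra (orbSet N) := carSubalgebra_mono (orbSet_mono_local hWN) hA
  rw [← sum_hubbardTermOp G t U μ, finset_sum_commutator]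
  refine Subalgebra.sum_mem _ fun Z _ => ?_
  by_cases hZ : Disjoint (hubbardTermSupp G Z) W
  · rw [(commute_hubbardTermOp_of_disjoint G t U μ Z hA hZ).eq, sub_self]
    exact Subalgebra.zero_mem _
  · have hT : hubbardTermOp G t U μ Z ∈ carSubalgebra (orbSet N) :=
      carSubalgebra_mono (orbSet_mono_local (hN Z hZ))
        (carEvenSubalgebra_le_carSubalgebra _ (hubbardTermOp_mem_carEvenSubalgebra G t U μ Z))
    exact Subalgebra.sub_mem _ (Subalgebra.mul_mem _ hT hA') (Subalgebra.mul_mem _ hA' hT)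

end CarGeneric

section DoubleCommutator

variable (L : ℕ) [NeZero L]

/-- The site of the local pair `P_x` displaced by `e`. -/
def pairSite (x : TorusSite 2 L) (e : Site 2) : FermionTorus 2 L :=
  FermionTorus.ofTorusSite (x + Torus.proj L e)

/-- The (at most six) sites carrying the local `d`-wave pair operator `P_x`. -/
def pairSupp (x : TorusSite 2 L) : Finset (FermionTorus 2 L) :=
  insert (FermionTorus.ofTorusSite x) ((insert (0 : Site 2) unitSteps).image (pairSite L x))

theorem ofTorusSite_mem_pairSupp (x : TorusSite 2 L) : FermionTorus.ofTorusSite x ∈ pairSupp L x :=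
  Finset.mem_insert_self _ _

theorem pairSite_mem_pairSupp (x : TorusSite 2 L) {e : Site 2} (he : e ∈ insert (0 : Site 2) unitSteps) :
    pairSite L x e ∈ pairSupp L x :=
  Finset.mem_insert_of_mem (Finset.mem_image_of_mem _ he)

omit [NeZero L] in
theorem card_insert_zero_unitSteps_le : (insert (0 : Site 2) unitSteps).card ≤ 5 := by
  refine (Finset.card_insert_le _ _).trans ?_
  have : unitSteps.card ≤ 4 := by
    unfold unitSteps
    refine (Finset.card_insert_le _ _).trans ?_
    refine (Nat.succ_le_succ (Finset.card_insert_le _ _)).trans ?_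
    refine (Nat.succ_le_succ (Nat.succ_le_succ (Finset.card_insert_le _ _))).trans ?_
    rw [Finset.card_singleton]
  omega

theorem card_pairSupp_le (x : TorusSite 2 L) : (pairSupp L x).card ≤ 6 := by
  unfold pairSupp
  refine (Finset.card_insert_le _ _).trans ?_
  have h1 := Finset.card_image_le (f := pairSite L x) (s := insert (0 : Site 2) unitSteps)
  have h2 := card_insert_zero_unitSteps_le
  omega

/-- **`P_x` is an even element of the CAR algebra of its sites.** -/
theorem localPair_mem_carEvenSubalgebra (x : TorusSite 2 L) :
    localPair dWaveFormFactor L x ∈ carEvenSubalgebra (orbSet (pairSupp L x)) :=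
  pairSum_mem_carEvenSubalgebra (insert (0 : Site 2) unitSteps) (fun e => dWaveFormFactor e / Real.sqrt 2)
    (FermionTorus.ofTorusSite x) (pairSite L x) (ofTorusSite_mem_pairSupp L x)
    (fun _ he => pairSite_mem_pairSupp L x he)

/-- **`P_xᴴ` is an even element of the CAR algebra of its sites.** -/
theorem localPair_conjTranspose_mem_carEvenSubalgebra (x : TorusSite 2 L) :
    (localPair dWaveFormFactor L x)ᴴ ∈ carEvenSubalgebra (orbSet (pairSupp L x)) :=
  pairSum_conjTranspose_mem_carEvenSubalgebra (insert (0 : Site 2) unitSteps)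
    (fun e => dWaveFormFactor e / Real.sqrt 2) (FermionTorus.ofTorusSite x) (pairSite L x)
    (ofTorusSite_mem_pairSupp L x) (fun _ he => pairSite_mem_pairSupp L x he)

open Classical in
/-- The closed graph neighbourhood of the support of `P_x`. -/
def pairNbhd (x : TorusSite 2 L) : Finset (FermionTorus 2 L) :=
  Finset.univ.filter fun z => ∃ w ∈ pairSupp L x, z = w ∨ (fermionTorusGraph 2 L).Adj z w

theorem pairSupp_subset_pairNbhd (x : TorusSite 2 L) : pairSupp L x ⊆ pairNbhd L x := by
  intro w hw
  unfold pairNbhd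
  simp only [Finset.mem_filter, Finset.mem_univ, true_and]
  exact ⟨w, hw, Or.inl rfl⟩

/-- A Hubbard term meeting the support of `P_x` lives inside its closed neighbourhood. -/
theorem hubbardTermSupp_subset_pairNbhd {x : TorusSite 2 L} (Z : HubbardIdx (fermionTorusGraph 2 L))
    (hZ : ¬ Disjoint (hubbardTermSupp (fermionTorusGraph 2 L) Z) (pairSupp L x)) :
    hubbardTermSupp (fermionTorusGraph 2 L) Z ⊆ pairNbhd L x := by
  rw [Finset.not_disjoint_iff] at hZ
  obtain ⟨w, hwZ, hwS⟩ := hZ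
  intro z hz
  unfold pairNbhd
  simp only [Finset.mem_filter, Finset.mem_univ, true_and]
  exact ⟨w, hwS, eq_or_adj_of_mem_hubbardTermSupp (fermionTorusGraph 2 L) hz hwZ⟩

/-- **`[H, P_x]` lives in the CAR algebra of the closed neighbourhood of the support of `P_x`.** -/
theorem commutator_localPair_mem_carSubalgebra (U μ : ℝ) (x : TorusSite 2 L) :
    hubbardTorusWith 2 L 1 U μ * localPair dWaveFormFactor L x -
        localPair dWaveFormFactor L x * hubbardTorusWith 2 L 1 U μ ∈
      carSubalgebra (orbSet (pairNbhd L x)) :=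
  commutator_mem_carSubalgebra (fermionTorusGraph 2 L) 1 U μ (pairSupp_subset_pairNbhd L x)
    (fun Z hZ => hubbardTermSupp_subset_pairNbhd L Z hZ)
    (carEvenSubalgebra_le_carSubalgebra _ (localPair_mem_carEvenSubalgebra L x))

/-- Graded locality: `[P_yᴴ, [H, P_x]] = 0` unless the support of `P_y` meets the neighbourhood
of the support of `P_x`. -/
theorem double_commutator_term_eq_zero (U μ : ℝ) {x y : TorusSite 2 L}
    (h : Disjoint (pairSupp L y) (pairNbhd L x)) :
    (localPair dWaveFormFactor L y)ᴴ *
        (hubbardTorusWith 2 L 1 U μ * localPair dWaveFormFactor L x -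
          localPair dWaveFormFactor L x * hubbardTorusWith 2 L 1 U μ) -
      (hubbardTorusWith 2 L 1 U μ * localPair dWaveFormFactor L x -
          localPair dWaveFormFactor L x * hubbardTorusWith 2 L 1 U μ) *
        (localPair dWaveFormFactor L y)ᴴ = 0 :=
  sub_eq_zero.mpr (commute_of_mem_carEvenSubalgebra (localPair_conjTranspose_mem_carEvenSubalgebra L y)
    (commutator_localPair_mem_carSubalgebra L U μ x) (disjoint_orbSet h)).eq

/-! ### Counting the `y` whose pair support meets the neighbourhood of `P_x` -/

theorem toTorusSite_pairSite (x : TorusSite 2 L) (e : Site 2) :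
    (pairSite L x e).toTorusSite = x + Torus.proj L e := by
  simp [pairSite]

omit [NeZero L] in
theorem proj_zero : Torus.proj L (0 : Site 2) = 0 := by
  funext i; simp [Torus.proj]

/-- Torus positions of the support of `P_y`: `y + proj e`, `e ∈ {0, ±e₁, ±e₂}`. -/
theorem exists_of_mem_pairSupp {y : TorusSite 2 L} {w : FermionTorus 2 L} (hw : w ∈ pairSupp L y) :
    ∃ e ∈ insert (0 : Site 2) unitSteps, w.toTorusSite = y + Torus.proj L e := by
  unfold pairSupp at hw
  rcases Finset.mem_insert.mp hw with rfl | hw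
  · exact ⟨0, Finset.mem_insert_self _ _, by rw [proj_zero, add_zero]; simp⟩
  · obtain ⟨e, he, rfl⟩ := Finset.mem_image.mp hw
    exact ⟨e, he, toTorusSite_pairSite L y e⟩

/-- The unit displacements `0, ±eᵢ` of the torus. -/
def unitDisp : Finset (TorusSite 2 L) :=
  insert 0 ((Finset.univ : Finset (Fin 2 × Bool)).image fun p =>
    if p.2 then (Pi.single p.1 1 : TorusSite 2 L) else -Pi.single p.1 1)

omit [NeZero L] in
theorem card_unitDisp_le : (unitDisp L).card ≤ 5 := by
  unfold unitDisp
  refine (Finset.card_insert_le _ _).trans ?_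
  have := Finset.card_image_le (s := (Finset.univ : Finset (Fin 2 × Bool)))
    (f := fun p : Fin 2 × Bool => if p.2 then (Pi.single p.1 1 : TorusSite 2 L) else -Pi.single p.1 1)
  have hc : (Finset.univ : Finset (Fin 2 × Bool)).card = 4 := by simp
  omega

omit [NeZero L] in
/-- Two sites that coincide or are adjacent differ by a unit displacement. -/
theorem exists_unitDisp_of_eq_or_adj {z w : FermionTorus 2 L} (h : z = w ∨ (fermionTorusGraph 2 L).Adj z w) :
    ∃ δ ∈ unitDisp L, z.toTorusSite = w.toTorusSite + δ := by
  rcases h with rfl | h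
  · exact ⟨0, Finset.mem_insert_self _ _, by rw [add_zero]⟩
  · rw [fermionTorusGraph_adj, torusGraph_adj_iff] at h
    obtain ⟨-, ⟨i, hi⟩ | ⟨i, hi⟩⟩ := h
    · refine ⟨-Pi.single i 1, ?_, ?_⟩
      · exact Finset.mem_insert_of_mem (Finset.mem_image.mpr ⟨(i, false), Finset.mem_univ _, rfl⟩)
      · rw [hi]; abel
    · refine ⟨Pi.single i 1, ?_, hi⟩
      exact Finset.mem_insert_of_mem (Finset.mem_image.mpr ⟨(i, true), Finset.mem_univ _, rfl⟩)

/-- The candidate set containing every `y` whose pair support meets the neighbourhood of `P_x`. -/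
def badCandidates (x : TorusSite 2 L) : Finset (TorusSite 2 L) :=
  ((insert (0 : Site 2) unitSteps) ×ˢ unitDisp L ×ˢ (insert (0 : Site 2) unitSteps)).image
    fun t => x + Torus.proj L t.1 + t.2.1 - Torus.proj L t.2.2

omit [NeZero L] in
theorem card_badCandidates_le (x : TorusSite 2 L) : (badCandidates L x).card ≤ 125 := by
  unfold badCandidates
  refine (Finset.card_image_le).trans ?_
  rw [Finset.card_product, Finset.card_product]
  have h5 := card_insert_zero_unitSteps_le
  have hD := card_unitDisp_le L
  calc (insert (0 : Site 2) unitSteps).card * ((unitDisp L).card * (insert (0 : Site 2) unitSteps).card)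
      ≤ 5 * (5 * 5) := Nat.mul_le_mul h5 (Nat.mul_le_mul hD h5)
    _ = 125 := by norm_num

/-- If the support of `P_y` meets the neighbourhood of `P_x` then `y` is a candidate. -/
theorem mem_badCandidates {x y : TorusSite 2 L} (h : ¬ Disjoint (pairSupp L y) (pairNbhd L x)) :
    y ∈ badCandidates L x := by
  rw [Finset.not_disjoint_iff] at h
  obtain ⟨w, hwy, hwx⟩ := h
  obtain ⟨e, he, hwe⟩ := exists_of_mem_pairSupp L hwy
  unfold pairNbhd at hwx
  simp only [Finset.mem_filter, Finset.mem_univ, true_and] at hwx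
  obtain ⟨w', hw', hrel⟩ := hwx
  obtain ⟨e', he', hw'e⟩ := exists_of_mem_pairSupp L hw'
  obtain ⟨δ, hδ, hδe⟩ := exists_unitDisp_of_eq_or_adj L hrel
  unfold badCandidates
  refine Finset.mem_image.mpr ⟨(e', δ, e), ?_, ?_⟩
  · exact Finset.mem_product.mpr ⟨he', Finset.mem_product.mpr ⟨hδ, he⟩⟩
  · have : y + Torus.proj L e = x + Torus.proj L e' + δ := by rw [← hwe, hδe, hw'e]
    simp only
    rw [← this]
    abel

end DoubleCommutator

section DoubleCommutatorNorms
open scoped Matrix.Norms.L2Operator ComplexOrder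

variable (L : ℕ) [NeZero L]

/-- **`‖[H, P_x]‖ ≤ 54 · 2(2 + |U| + 2|μ|) · 4√2`**, uniformly in `L` and `x`. -/
theorem norm_commutator_localPair_le (U μ : ℝ) (x : TorusSite 2 L) :
    ‖hubbardTorusWith 2 L 1 U μ * localPair dWaveFormFactor L x -
        localPair dWaveFormFactor L x * hubbardTorusWith 2 L 1 U μ‖ ≤
      54 * (2 * (2 + |U| + 2 * |μ|) * (4 * Real.sqrt 2)) := by
  have hA : localPair dWaveFormFactor L x ∈ carSubalgebra (orbSet (pairSupp L x)) :=
    carEvenSubalgebra_le_carSubalgebra _ (localPair_mem_carEvenSubalgebra L x)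
  have h := norm_commutator_hamiltonianWith_le (fermionTorusGraph 2 L) (Δ := 4)
    (fun v => SourceGas.card_filter_fermionTorusGraph_adj_le v) 1 U μ hA
  rw [hubbardTorusWith]
  refine h.trans ?_
  have hcard : ((pairSupp L x).card * (2 * 4 + 1) : ℕ) ≤ 54 := by
    have := card_pairSupp_le L x
    omega
  have hP := norm_localPair_dWave_le L x
  have hnn : 0 ≤ 2 * (2 * |(1 : ℝ)| + |U| + 2 * |μ|) := by positivity
  calc (((pairSupp L x).card * (2 * 4 + 1) : ℕ) : ℝ) * (2 * (2 * |(1 : ℝ)| + |U| + 2 * |μ|) *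
        ‖localPair dWaveFormFactor L x‖)
      ≤ (54 : ℝ) * (2 * (2 * |(1 : ℝ)| + |U| + 2 * |μ|) * (4 * Real.sqrt 2)) := by
        apply mul_le_mul (by exact_mod_cast hcard) (mul_le_mul_of_nonneg_left hP hnn)
          (by positivity) (by norm_num)
    _ = 54 * (2 * (2 + |U| + 2 * |μ|) * (4 * Real.sqrt 2)) := by rw [abs_one]; ring

/-- The constant of the double-commutator bound: `κ(U,μ) = 125 · 2 · 4√2 · 54 · 2(2+|U|+2|μ|) · 4√2`. -/
def dcConst (U μ : ℝ) : ℝ :=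
  125 * (2 * (4 * Real.sqrt 2) * (54 * (2 * (2 + |U| + 2 * |μ|) * (4 * Real.sqrt 2))))

omit [NeZero L] in
theorem dcConst_nonneg (U μ : ℝ) : 0 ≤ dcConst U μ := by unfold dcConst; positivity

/-- One term of the double sum: `‖[P_yᴴ, [H, P_x]]‖ ≤ 2 ‖P_y‖ ‖[H,P_x]‖ ≤ 2 · 4√2 · (54 · …)`. -/
theorem norm_double_commutator_term_le (U μ : ℝ) (x y : TorusSite 2 L) :
    ‖(localPair dWaveFormFactor L y)ᴴ *
        (hubbardTorusWith 2 L 1 U μ * localPair dWaveFormFactor L x -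
          localPair dWaveFormFactor L x * hubbardTorusWith 2 L 1 U μ) -
      (hubbardTorusWith 2 L 1 U μ * localPair dWaveFormFactor L x -
          localPair dWaveFormFactor L x * hubbardTorusWith 2 L 1 U μ) *
        (localPair dWaveFormFactor L y)ᴴ‖ ≤
      2 * (4 * Real.sqrt 2) * (54 * (2 * (2 + |U| + 2 * |μ|) * (4 * Real.sqrt 2))) := by
  set P := (localPair dWaveFormFactor L y)ᴴ
  set C := hubbardTorusWith 2 L 1 U μ * localPair dWaveFormFactor L x -
          localPair dWaveFormFactor L x * hubbardTorusWith 2 L 1 U μ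
  have hP : ‖P‖ ≤ 4 * Real.sqrt 2 := by
    rw [Matrix.l2_opNorm_conjTranspose]; exact norm_localPair_dWave_le L y
  have hC : ‖C‖ ≤ 54 * (2 * (2 + |U| + 2 * |μ|) * (4 * Real.sqrt 2)) := norm_commutator_localPair_le L U μ x
  calc ‖P * C - C * P‖ ≤ ‖P * C‖ + ‖C * P‖ := norm_sub_le _ _
    _ ≤ ‖P‖ * ‖C‖ + ‖C‖ * ‖P‖ := add_le_add (norm_mul_le _ _) (norm_mul_le _ _)
    _ = 2 * ‖P‖ * ‖C‖ := by ring
    _ ≤ 2 * (4 * Real.sqrt 2) * (54 * (2 * (2 + |U| + 2 * |μ|) * (4 * Real.sqrt 2))) := by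
        gcongr

/-- The double commutator as a double sum of local terms. -/
theorem dWaveDoubleCommutator_eq_sum (U μ : ℝ) :
    dWaveDoubleCommutator L U μ = ∑ y : TorusSite 2 L, ∑ x : TorusSite 2 L,
      ((localPair dWaveFormFactor L y)ᴴ *
          (hubbardTorusWith 2 L 1 U μ * localPair dWaveFormFactor L x -
            localPair dWaveFormFactor L x * hubbardTorusWith 2 L 1 U μ) -
        (hubbardTorusWith 2 L 1 U μ * localPair dWaveFormFactor L x -
            localPair dWaveFormFactor L x * hubbardTorusWith 2 L 1 U μ) *
          (localPair dWaveFormFactor L y)ᴴ) := by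
  have hcomm : hubbardTorusWith 2 L 1 U μ * pairField dWaveFormFactor L -
      pairField dWaveFormFactor L * hubbardTorusWith 2 L 1 U μ =
      ∑ x : TorusSite 2 L, (hubbardTorusWith 2 L 1 U μ * localPair dWaveFormFactor L x -
        localPair dWaveFormFactor L x * hubbardTorusWith 2 L 1 U μ) := by
    rw [pairField, Finset.mul_sum, Finset.sum_mul, ← Finset.sum_sub_distrib]
  have hadj : (pairField dWaveFormFactor L)ᴴ = ∑ y : TorusSite 2 L, (localPair dWaveFormFactor L y)ᴴ := by
    rw [pairField, conjTranspose_sum]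
  rw [dWaveDoubleCommutator, hcomm, hadj, finset_sum_commutator]
  refine Finset.sum_congr rfl fun y _ => ?_
  rw [Finset.mul_sum, Finset.sum_mul, ← Finset.sum_sub_distrib]

/-- **The double commutator is `O(L²)`: `‖[Δ_dᴴ,[H,Δ_d]]‖ ≤ κ(U,μ) · L²`** (graded locality: for each
`x` only the `≤ 125` operators `P_y` whose support meets the neighbourhood of `P_x` contribute). -/
theorem norm_dWaveDoubleCommutator_le (U μ : ℝ) :
    ‖dWaveDoubleCommutator L U μ‖ ≤ dcConst U μ * (L : ℝ) ^ 2 := by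
  set B : ℝ := 2 * (4 * Real.sqrt 2) * (54 * (2 * (2 + |U| + 2 * |μ|) * (4 * Real.sqrt 2))) with hB
  have hBnn : 0 ≤ B := by positivity
  set T : TorusSite 2 L → TorusSite 2 L → Matrix (Finset (Orb (FermionTorus 2 L))) (Finset (Orb (FermionTorus 2 L))) ℂ :=
    fun y x => (localPair dWaveFormFactor L y)ᴴ *
          (hubbardTorusWith 2 L 1 U μ * localPair dWaveFormFactor L x -
            localPair dWaveFormFactor L x * hubbardTorusWith 2 L 1 U μ) -
        (hubbardTorusWith 2 L 1 U μ * localPair dWaveFormFactor L x -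
            localPair dWaveFormFactor L x * hubbardTorusWith 2 L 1 U μ) *
          (localPair dWaveFormFactor L y)ᴴ with hT
  have hsum : dWaveDoubleCommutator L U μ = ∑ y : TorusSite 2 L, ∑ x : TorusSite 2 L, T y x :=
    dWaveDoubleCommutator_eq_sum L U μ
  -- per-x bound on the y-sum
  have hx : ∀ x : TorusSite 2 L, ∑ y : TorusSite 2 L, ‖T y x‖ ≤ 125 * B := by
    intro x
    classical
    have hterm : ∀ y : TorusSite 2 L, ‖T y x‖ ≤ if Disjoint (pairSupp L y) (pairNbhd L x) then 0 else B := by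
      intro y
      by_cases h : Disjoint (pairSupp L y) (pairNbhd L x)
      · rw [if_pos h, show T y x = 0 from double_commutator_term_eq_zero L U μ h, norm_zero]
      · rw [if_neg h]
        exact norm_double_commutator_term_le L U μ x y
    calc ∑ y : TorusSite 2 L, ‖T y x‖
        ≤ ∑ y : TorusSite 2 L, (if Disjoint (pairSupp L y) (pairNbhd L x) then 0 else B) :=
          Finset.sum_le_sum fun y _ => hterm y
      _ = B * ((Finset.univ.filter fun y : TorusSite 2 L => ¬ Disjoint (pairSupp L y) (pairNbhd L x)).card) := by
          rw [Finset.sum_ite, Finset.sum_const_zero, zero_add, Finset.sum_const, nsmul_eq_mul, mul_comm]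
      _ ≤ B * 125 := by
          gcongr
          have hsub : (Finset.univ.filter fun y : TorusSite 2 L => ¬ Disjoint (pairSupp L y) (pairNbhd L x)) ⊆
              badCandidates L x := fun y hy => mem_badCandidates L (Finset.mem_filter.mp hy).2
          exact_mod_cast (Finset.card_le_card hsub).trans (card_badCandidates_le L x)
      _ = 125 * B := mul_comm _ _
  calc ‖dWaveDoubleCommutator L U μ‖ = ‖∑ y : TorusSite 2 L, ∑ x : TorusSite 2 L, T y x‖ := by rw [hsum]
    _ ≤ ∑ y : TorusSite 2 L, ‖∑ x : TorusSite 2 L, T y x‖ := norm_sum_le _ _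
    _ ≤ ∑ y : TorusSite 2 L, ∑ x : TorusSite 2 L, ‖T y x‖ := Finset.sum_le_sum fun y _ => norm_sum_le _ _
    _ = ∑ x : TorusSite 2 L, ∑ y : TorusSite 2 L, ‖T y x‖ := Finset.sum_comm
    _ ≤ ∑ _x : TorusSite 2 L, 125 * B := Finset.sum_le_sum fun x _ => hx x
    _ = 125 * B * (L : ℝ) ^ 2 := by rw [Finset.sum_const, card_univ, nsmul_eq_mul, card_torusSite]; ring
    _ = dcConst U μ * (L : ℝ) ^ 2 := by rw [dcConst, hB]

/-- **EXPLICIT GC-EXPOSED CEILING** (consequence of the crux, fully proved): in the crux's regime,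
every `N ≥ 4`-particle unit global ground vector of `H = hubbardTorusWith 2 L 1 U μ` has
`P² ≤ 2K·κ(U,μ)L² + 4K(L² log 4/β)·P`, `P = ⟨ψ, Δ_dᴴΔ_dψ⟩`, `K = C(1+log β)L²` — i.e.
`(P/L⁴)² ≤ 2C(1+log β)κ(U,μ)/L⁴ + 4C(1+log β)(log 4/β)(P/L⁴)`, an `e^{−a/U}` ceiling as `L → ∞`. -/
def TwGcExplicitCeiling : Prop :=
  ∀ μ₁ μ₂ : ℝ, -4 < μ₁ → μ₁ ≤ μ₂ → μ₂ < 0 → ∃ U₀ a C : ℝ, 0 < U₀ ∧ 0 < a ∧ 0 < C ∧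
    ∀ U : ℝ, 0 < U → U ≤ U₀ → ∀ β : ℝ, 1 ≤ β → β ≤ Real.exp (a / U) → ∀ μ ∈ Set.Icc μ₁ μ₂,
      ∃ L₀ : ℕ, ∀ (L : ℕ) [NeZero L], L₀ ≤ L →
        ∀ (M : ℕ) (E : ℝ) (ψ : Fock (Orb (FermionTorus 2 L))), star ψ ⬝ᵥ ψ = 1 →
          IsNParticle (M + 4) ψ → hubbardTorusWith 2 L 1 U μ *ᵥ ψ = (E : ℂ) • ψ →
          (∀ x, E * (star x ⬝ᵥ x).re ≤ (star x ⬝ᵥ hubbardTorusWith 2 L 1 U μ *ᵥ x).re) →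
          (star ψ ⬝ᵥ ((pairField dWaveFormFactor L)ᴴ * pairField dWaveFormFactor L) *ᵥ ψ).re ^ 2 ≤
            2 * (C * (1 + Real.log β) * (L : ℝ) ^ 2) * (dcConst U μ * (L : ℝ) ^ 2) +
              4 * (C * (1 + Real.log β) * (L : ℝ) ^ 2) * ((L : ℝ) ^ 2 * Real.log 4 / β) *
                (star ψ ⬝ᵥ ((pairField dWaveFormFactor L)ᴴ * pairField dWaveFormFactor L) *ᵥ ψ).re

/-- **The crux implies the explicit GC-exposed exponential ceiling.** -/
theorem gcExplicitCeiling_of_inertness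
    (hI : Summit.HubbardSuperconductivity.HubbardSuperconductivity.Theses.ThermalWedge.TwSourcedInertness) :
    TwGcExplicitCeiling := by
  intro μ₁ μ₂ h1 h2 h3
  obtain ⟨U₀, a, C, hU₀, ha, hC, hmain⟩ := gcLRO_bound_of_inertness hI μ₁ μ₂ h1 h2 h3
  refine ⟨U₀, a, C, hU₀, ha, hC, ?_⟩
  intro U hU hUU₀ β hβ hβa μ hμ
  obtain ⟨L₀, hL⟩ := hmain U hU hUU₀ β hβ hβa μ hμ
  refine ⟨L₀, fun L _ hLL M E ψ hψ hN hHψ hfloor => ?_⟩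
  have key := hL L hLL M E ψ hψ hN hHψ hfloor
  have hD := norm_dWaveDoubleCommutator_le L U μ
  have hlog : 0 < 1 + Real.log β := by have := Real.log_nonneg hβ; linarith
  have hK : 0 ≤ 2 * (C * (1 + Real.log β) * (L : ℝ) ^ 2) := by positivity
  have := mul_le_mul_of_nonneg_left hD hK
  linarith

end DoubleCommutatorNorms

end Summit.HubbardSuperconductivity.HubbardSuperconductivity.Cruxes.TwSourcedInertness.KlsCeiling
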